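import Mathlib.Analysis.SpecialFunctions.Trigonometric.ArctanDeriv
import Mathlib.Analysis.SpecialFunctions.Sqrt
import Mathlib.Analysis.Calculus.MeanValue
import Mathlib.Analysis.Real.Pi.Bounds
import Mathlib.Topology.Algebra.InfiniteSum.Real
import Mathlib.Data.Fin.VecNotation
import Literature.Analysis.FunctionSpaces.TorusSobolevNorm
import HarnessLib

/-!
# The simple-cubic lattice sums `∑'_{k ∈ ℤ³∖0} |k|⁻⁴` and `∑' |k|⁻⁶`: kernel-certified enclosures

FunctionSpaces support file (theorems; private plumbing definitions only; no named facts). Search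
for candidate a priori estimates; no regularity claim.

J. E. Jones and A. E. Ingham, *Proc. R. Soc. Lond. A* 107 (1925) 636–653, Table I ("Potential
Constants for Cubic Crystals"), list for the simple cubic lattice (nearest-neighbour distance one)
the lattice sums `A_n = ∑'_{k ∈ ℤ³, k ≠ 0} |k|^{−n}`:
"`A₄ = 16·5323`", "`A₆ = 8·40192`" (reproduced as the Madelung-type constants `M₄ = 16.53`,
`M₆ = 8.40` of the simple cubic lattice in M. Baus, C. F. Tejero, *Equilibrium Statistical
Physics*, Springer 2021, Table 8.2, after Ashcroft–Mermin). In the tree these are the sums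
`∑'_{k : d → ℤ} (freqNormSq k)⁻²` and `∑' (freqNormSq k)⁻³` (`Fintype.card d = 3`,
`Torus.freqNormSq k = ∑ᵢ kᵢ²`; the `k = 0` term vanishes by `0⁻¹ = 0`), i.e. the Epstein zeta
values `ζ₄(ℤ³)`, `ζ₆(ℤ³)` that carry the hypothesis-free Kato / transport constants
`G = 2π(24ζ₄)^{1/2}`, `K = 2π(B₃ζ₆)^{1/2}` of `FluidPDE/TorusNSKatoPairInequality` §6–§7 and of
every `_three` statement of `FluidPDE/TorusNSSobolevControlInequality` / `…ControlLifespan`.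

## What is proved (our proof of the printed values, as two-sided enclosures)

* `Torus.le_tsum_inv_freqNormSq_sq_three`, `Torus.tsum_inv_freqNormSq_sq_le_three`:
  `16.1221115 ≤ ∑'_{k} (freqNormSq k)⁻² ≤ 16.6213` (`card d = 3`); printed value `16.5323`.
* `Torus.le_tsum_inv_freqNormSq_cube_three`, `Torus.tsum_inv_freqNormSq_cube_le_three`:
  `8.401306 ≤ ∑'_{k} (freqNormSq k)⁻³ ≤ 8.4034`; printed value `8.40192`.
* the same sums in the `if k = 0 then 0 else freqNormSq k ^ (−2)` / `^ (−3)` (`rpow`) shape used by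
  the `Ḣ^s` control files at `s = 3` (`Torus.tsum_ite_freqNormSq_rpow_neg_two_le_three`, `…_ge_…`,
  `…_neg_three_…`), summability, and the `ℤ × ℤ × ℤ` forms (`Torus.tsum_int3_inv_normSq_sq_le`, …).

Consequently `G = 2π(24ζ₄)^{1/2} ≤ 2π(24 · 16.6213)^{1/2} < 125.5` and
`K = 2π((2⁸4⁴/5⁵)ζ₆)^{1/2} < 83.5` (evaluated where used, not here).

## Method (elementary; integral-free)

Write the sum as the limit of the box sums `B(M) = ∑_{‖k‖∞ ≤ M} |k|⁻⁴`. For `N ≤ M`,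
`B(M) = B(N) + T₃ + T₂ + T₁` with the slabs `T₁ = ∑_{|a| > N} ∑_{b, c}`, `T₂ = ∑_{|a| ≤ N} ∑_{|b| > N} ∑_c`,
`T₃ = ∑_{|a|,|b| ≤ N} ∑_{|c| > N}` (`boxSum_eq_add_slabs`). The slabs are bounded by one-dimensional
telescoping sums: `∑_{c ≥ 1} (B + c²)⁻² ≤ π/(4B√B)` through the antiderivative
`x/(2B(B+x²)) + arctan(x/√B)/(2B√B)` and the mean value theorem, using
`arctan t + t/(1+t²) ≤ π/2` (`t ≥ 0`); `∑_{b ≥ 1} ((A + b²)√(A+b²))⁻¹ ≤ M/(A√(A+M²)) ≤ 1/A`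
through `x/(A√(A+x²))`; and `∑_{n > N} n⁻² ≤ 1/N`, `n⁻³ ≤ 1/(2N²)`, `n⁻⁴ ≤ 1/(3N³)`. This gives
`B(M) ≤ B(N) + τ(N)`, `τ(N) = 2(1/(3N³) + π/(2N²) + π/N) + 2(2N+1)(1/(3N³) + π/(4N²)) + 2(2N+1)²/(3N³)`
(`= (3π + 8/3)/N + O(N⁻²)`; `τ(25) ≤ 0.4978`), and for `|k|⁻⁶` the slabs carry the extra factor
`(N+1)⁻²`. The finite box `B(25)` is certified by the kernel: each term `1/m²`, `m = a²+b²+c²`, is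
replaced by the ceiling rational `⌈10⁸/m²⌉/10⁸` (resp. floor, for the lower bound) and the resulting
natural-number triple sum over `51³ = 132651` lattice points is evaluated by `decide +kernel`
(`∑ ⌈10⁸/|k|⁴⌉ = 1612342642`, `∑ ⌊10⁸/|k|⁴⌋ = 1612211150`, `∑ ⌈10⁸/|k|⁶⌉ = 840263010`,
`∑ ⌊10⁸/|k|⁶⌋ = 840130600`). The enclosure widths (`3 %` resp. `0.03 %`) are those of the tail
majorant at `N = 25`; sharper values need only a larger `N`.

## Mathlib / tree search

Mathlib: `riemannZeta` special values (`riemannZeta_two`, `riemannZeta_four`), `Real.pi` bounds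
(`Real.pi_lt_d6`), no multi-dimensional lattice sums (searched `Epstein`, `latticeSum`, `Madelung`).
Tree: binary Epstein zeta functions (`Barriers/RiemannHypothesis/EpsteinZeta*`), tail bounds with an
inexplicit constant (`TorusWienerSobolevInterpolation.exists_tsum_compl_freqBall_rpow_neg_le`);
no numerical value of a ternary lattice sum.

## References

* J. E. Jones, A. E. Ingham, Proc. R. Soc. Lond. A 107 (1925) 636–653, doi:10.1098/rspa.1925.0047,
  Table I (simple cubic column `A_n`: `A₄ = 16.5323`, `A₆ = 8.40192`). [JonesIngham1925]
* M. Baus, C. F. Tejero, *Equilibrium Statistical Physics*, Springer 2021,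
  doi:10.1007/978-3-030-75432-7, §8, Table 8.2 (sc: `M₄ = 16.53`, `M₆ = 8.40`). [BausTejero2021]
-/

noncomputable section

open Real Finset Set

namespace Literature.Analysis.FunctionSpaces.Torus

namespace CubicLattice


/-- `u/(1+u²) ≤ arctan u` for `u ≥ 0`. [folklore] -/
private theorem div_one_add_sq_le_arctan {u : ℝ} (hu : 0 ≤ u) : u / (1 + u ^ 2) ≤ Real.arctan u := by
  -- φ(u) = arctan u - u/(1+u²) is monotone on [0, ∞) with φ(0) = 0
  set φ : ℝ → ℝ := fun u => Real.arctan u - u / (1 + u ^ 2) with hφ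
  have hderiv : ∀ x : ℝ, HasDerivAt φ (2 * x ^ 2 / (1 + x ^ 2) ^ 2) x := by
    intro x
    have hx : (1 + x ^ 2) ≠ 0 := by positivity
    have h1 : HasDerivAt (fun u : ℝ => u / (1 + u ^ 2))
        ((1 * (1 + x ^ 2) - x * (2 * x)) / (1 + x ^ 2) ^ 2) x := by
      have hden : HasDerivAt (fun u : ℝ => 1 + u ^ 2) (2 * x) x := by
        simpa using ((hasDerivAt_pow 2 x).const_add 1)
      exact (hasDerivAt_id x).div hden hx
    have h2 := (Real.hasDerivAt_arctan x).sub h1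
    refine h2.congr_deriv ?_
    field_simp
    ring
  have hmono : MonotoneOn φ (Ici 0) := by
    refine monotoneOn_of_deriv_nonneg (convex_Ici 0) ?_ ?_ ?_
    · exact HasDerivAt.continuousOn fun x _ => hderiv x
    · exact fun x _ => (hderiv x).differentiableAt.differentiableWithinAt
    · intro x _
      rw [(hderiv x).deriv]
      positivity
  have h0 : φ 0 = 0 := by simp [φ]
  have := hmono (self_mem_Ici) (mem_Ici.2 hu) hu
  rw [h0] at this
  simpa [φ] using this

/-- `arctan t + t/(1+t²) ≤ π/2` for `t ≥ 0`. [folklore] -/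
private theorem arctan_add_div_le_pi_div_two {t : ℝ} (ht : 0 ≤ t) :
    Real.arctan t + t / (1 + t ^ 2) ≤ π / 2 := by
  rcases ht.eq_or_lt with h | h
  · rw [← h]; simp; positivity
  · have hinv : Real.arctan t = π / 2 - Real.arctan t⁻¹ := by
      rw [Real.arctan_inv_of_pos h]; ring
    have hu : t / (1 + t ^ 2) = t⁻¹ / (1 + t⁻¹ ^ 2) := by
      field_simp
      ring
    rw [hinv, hu]
    have := div_one_add_sq_le_arctan (inv_pos.2 h).le
    linarith

/-- The antiderivative `F_B(x) = x/(2B(B+x²)) + arctan(x/√B)/(2B√B)` of `(B+x²)⁻²`. [folklore] -/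
private theorem hasDerivAt_arctanAux {B : ℝ} (hB : 0 < B) (x : ℝ) :
    HasDerivAt (fun x : ℝ => x / (2 * B * (B + x ^ 2)) + Real.arctan (x / Real.sqrt B) / (2 * B * Real.sqrt B))
      (((B + x ^ 2) ^ 2)⁻¹) x := by
  have hsB : 0 < Real.sqrt B := Real.sqrt_pos.2 hB
  have hsq : Real.sqrt B ^ 2 = B := Real.sq_sqrt hB.le
  have hBx : 0 < B + x ^ 2 := by positivity
  have h1 : HasDerivAt (fun x : ℝ => x / (2 * B * (B + x ^ 2)))
      ((1 * (2 * B * (B + x ^ 2)) - x * (2 * B * (2 * x))) / (2 * B * (B + x ^ 2)) ^ 2) x := by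
    have hden : HasDerivAt (fun u : ℝ => 2 * B * (B + u ^ 2)) (2 * B * (2 * x)) x := by
      have := ((hasDerivAt_pow 2 x).const_add B).const_mul (2 * B)
      simpa using this
    exact (hasDerivAt_id x).div hden (by positivity)
  have h2 : HasDerivAt (fun x : ℝ => Real.arctan (x / Real.sqrt B) / (2 * B * Real.sqrt B))
      ((1 / (1 + (x / Real.sqrt B) ^ 2) * (1 / Real.sqrt B)) / (2 * B * Real.sqrt B)) x := by
    have hlin : HasDerivAt (fun u : ℝ => u / Real.sqrt B) (1 / Real.sqrt B) x := by
      simpa using (hasDerivAt_id x).div_const (Real.sqrt B)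
    exact ((Real.hasDerivAt_arctan _).comp x hlin).div_const _
  refine (h1.add h2).congr_deriv ?_
  field_simp
  rw [hsq]
  ring

/-- `∑_{i<M} (B + (i+1)²)⁻² ≤ π/(4B√B)` for `B > 0`. [folklore] -/
private theorem sum_range_inv_sq_add_sq_le {B : ℝ} (hB : 0 < B) (M : ℕ) :
    ∑ i ∈ Finset.range M, ((B + ((i : ℝ) + 1) ^ 2) ^ 2)⁻¹ ≤ π / (4 * B * Real.sqrt B) := by
  set F : ℝ → ℝ := fun x => x / (2 * B * (B + x ^ 2)) +
    Real.arctan (x / Real.sqrt B) / (2 * B * Real.sqrt B) with hF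
  have hsB : 0 < Real.sqrt B := Real.sqrt_pos.2 hB
  -- each term is bounded by an increment of F
  have hstep : ∀ i : ℕ, ((B + ((i : ℝ) + 1) ^ 2) ^ 2)⁻¹ ≤ F ((i : ℝ) + 1) - F (i : ℝ) := by
    intro i
    have hab : (i : ℝ) < (i : ℝ) + 1 := by linarith
    obtain ⟨ξ, hξ, hslope⟩ := exists_hasDerivAt_eq_slope F (fun x => ((B + x ^ 2) ^ 2)⁻¹) hab
      (HasDerivAt.continuousOn fun x _ => hasDerivAt_arctanAux hB x)
      (fun x _ => hasDerivAt_arctanAux hB x)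
    rw [add_sub_cancel_left, div_one] at hslope
    rw [← hslope]
    have hξ0 : 0 ≤ ξ := by
      have := hξ.1; have : (0 : ℝ) ≤ i := Nat.cast_nonneg i; linarith
    have hξ1 : ξ ≤ (i : ℝ) + 1 := hξ.2.le
    gcongr
  have hsum : ∑ i ∈ Finset.range M, ((B + ((i : ℝ) + 1) ^ 2) ^ 2)⁻¹ ≤ F M - F 0 := by
    calc ∑ i ∈ Finset.range M, ((B + ((i : ℝ) + 1) ^ 2) ^ 2)⁻¹
        ≤ ∑ i ∈ Finset.range M, (F ((i : ℝ) + 1) - F (i : ℝ)) := Finset.sum_le_sum fun i _ => hstep i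
      _ = F M - F 0 := by
        have h := Finset.sum_range_sub (fun i : ℕ => F (i : ℝ)) M
        simp only [Nat.cast_add, Nat.cast_one, Nat.cast_zero] at h
        exact h
  have hF0 : F 0 = 0 := by simp [hF]
  -- F M ≤ π/(4B√B)
  have hFM : F M ≤ π / (4 * B * Real.sqrt B) := by
    set t : ℝ := (M : ℝ) / Real.sqrt B with ht
    have ht0 : 0 ≤ t := div_nonneg (Nat.cast_nonneg M) hsB.le
    have hsq : Real.sqrt B ^ 2 = B := Real.sq_sqrt hB.le
    have hkey : F M = (Real.arctan t + t / (1 + t ^ 2)) / (2 * B * Real.sqrt B) := by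
      rw [hF, ht]
      field_simp
      rw [hsq]
      ring
    rw [hkey]
    have := arctan_add_div_le_pi_div_two ht0
    calc (Real.arctan t + t / (1 + t ^ 2)) / (2 * B * Real.sqrt B)
        ≤ (π / 2) / (2 * B * Real.sqrt B) := div_le_div_of_nonneg_right this (by positivity)
      _ = π / (4 * B * Real.sqrt B) := by ring
  linarith

/-- The antiderivative `G_A(x) = x/(A√(A+x²))` of `((A+x²)√(A+x²))⁻¹`. [folklore] -/
private theorem hasDerivAt_sqrtAux {A : ℝ} (hA : 0 < A) (x : ℝ) :
    HasDerivAt (fun x : ℝ => x / (A * Real.sqrt (A + x ^ 2)))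
      (((A + x ^ 2) * Real.sqrt (A + x ^ 2))⁻¹) x := by
  have hAx : 0 < A + x ^ 2 := by positivity
  have hsx0 : 0 < Real.sqrt (A + x ^ 2) := Real.sqrt_pos.2 hAx
  have hden : HasDerivAt (fun u : ℝ => A * Real.sqrt (A + u ^ 2))
      (A * ((2 * x) / (2 * Real.sqrt (A + x ^ 2)))) x := by
    have h1 : HasDerivAt (fun u : ℝ => A + u ^ 2) (2 * x) x := by
      simpa using ((hasDerivAt_pow 2 x).const_add A)
    exact (h1.sqrt hAx.ne').const_mul A
  have h := (hasDerivAt_id x).div hden (by positivity : A * Real.sqrt (A + x ^ 2) ≠ 0)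
  simp only [id] at h
  refine h.congr_deriv ?_
  set s : ℝ := Real.sqrt (A + x ^ 2) with hs
  have hs2 : s ^ 2 = A + x ^ 2 := Real.sq_sqrt hAx.le
  have hA' : A = s ^ 2 - x ^ 2 := by linarith
  have h3 : s ^ 2 - x ^ 2 ≠ 0 := by rw [← hA']; exact hA.ne'
  have hs3 : (s ^ 2 - x ^ 2 + x ^ 2) = s ^ 2 := by ring
  rw [hA', hs3]
  field_simp

/-- `∑_{i<M} ((A + (i+1)²)√(A+(i+1)²))⁻¹ ≤ M/(A√(A+M²))` for `A > 0`. [folklore] -/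
private theorem sum_range_inv_three_half_le {A : ℝ} (hA : 0 < A) (M : ℕ) :
    ∑ i ∈ Finset.range M, ((A + ((i : ℝ) + 1) ^ 2) * Real.sqrt (A + ((i : ℝ) + 1) ^ 2))⁻¹ ≤
      (M : ℝ) / (A * Real.sqrt (A + (M : ℝ) ^ 2)) := by
  set G : ℝ → ℝ := fun x => x / (A * Real.sqrt (A + x ^ 2)) with hG
  have hstep : ∀ i : ℕ, ((A + ((i : ℝ) + 1) ^ 2) * Real.sqrt (A + ((i : ℝ) + 1) ^ 2))⁻¹ ≤
      G ((i : ℝ) + 1) - G (i : ℝ) := by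
    intro i
    have hab : (i : ℝ) < (i : ℝ) + 1 := by linarith
    obtain ⟨ξ, hξ, hslope⟩ := exists_hasDerivAt_eq_slope G
      (fun x => ((A + x ^ 2) * Real.sqrt (A + x ^ 2))⁻¹) hab
      (HasDerivAt.continuousOn fun x _ => hasDerivAt_sqrtAux hA x)
      (fun x _ => hasDerivAt_sqrtAux hA x)
    rw [add_sub_cancel_left, div_one] at hslope
    rw [← hslope]
    have hξ0 : 0 ≤ ξ := by
      have := hξ.1; have : (0 : ℝ) ≤ i := Nat.cast_nonneg i; linarith
    have hξ1 : ξ ≤ (i : ℝ) + 1 := hξ.2.le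
    have hAξ : 0 < A + ξ ^ 2 := by positivity
    gcongr
  calc ∑ i ∈ Finset.range M, ((A + ((i : ℝ) + 1) ^ 2) * Real.sqrt (A + ((i : ℝ) + 1) ^ 2))⁻¹
      ≤ ∑ i ∈ Finset.range M, (G ((i : ℝ) + 1) - G (i : ℝ)) := Finset.sum_le_sum fun i _ => hstep i
    _ = G M - G 0 := by
        have h := Finset.sum_range_sub (fun i : ℕ => G (i : ℝ)) M
        simp only [Nat.cast_add, Nat.cast_one, Nat.cast_zero] at h
        exact h
    _ = (M : ℝ) / (A * Real.sqrt (A + (M : ℝ) ^ 2)) := by simp [hG]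

/-- Corollary: `∑_{i<M} ((A + (i+1)²)^{3/2})⁻¹ ≤ 1/A`. [folklore] -/
private theorem sum_range_inv_three_half_le_inv {A : ℝ} (hA : 0 < A) (M : ℕ) :
    ∑ i ∈ Finset.range M, ((A + ((i : ℝ) + 1) ^ 2) * Real.sqrt (A + ((i : ℝ) + 1) ^ 2))⁻¹ ≤ A⁻¹ := by
  refine (sum_range_inv_three_half_le hA M).trans ?_
  have hs : (M : ℝ) ≤ Real.sqrt (A + (M : ℝ) ^ 2) := by
    rw [show (M : ℝ) = Real.sqrt ((M : ℝ) ^ 2) by rw [Real.sqrt_sq (Nat.cast_nonneg M)]]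
    exact Real.sqrt_le_sqrt (by rw [Real.sqrt_sq (Nat.cast_nonneg M)]; linarith)
  have hs0 : 0 < Real.sqrt (A + (M : ℝ) ^ 2) := Real.sqrt_pos.2 (by positivity)
  rw [div_le_iff₀ (by positivity), inv_mul_eq_div, le_div_iff₀ hA]
  nlinarith

/-- Telescoping bound for a shifted tail sum: if `f (n+1) ≤ g n - g (n+1)` for `n ≥ N` and
`g ≥ 0`, then `∑_{i<M} f (N+i+1) ≤ g N`. [folklore] -/
private theorem sum_range_le_of_telescope {f g : ℕ → ℝ} {N : ℕ} (M : ℕ)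
    (h : ∀ n, N ≤ n → f (n + 1) ≤ g n - g (n + 1)) (hg : ∀ n, 0 ≤ g n) :
    ∑ i ∈ Finset.range M, f (N + i + 1) ≤ g N := by
  calc ∑ i ∈ Finset.range M, f (N + i + 1)
      ≤ ∑ i ∈ Finset.range M, (g (N + i) - g (N + i + 1)) :=
        Finset.sum_le_sum fun i _ => h (N + i) (Nat.le_add_right N i)
    _ = g N - g (N + M) := by
        have := Finset.sum_range_sub' (fun i => g (N + i)) M
        simpa [Nat.add_assoc] using this
    _ ≤ g N := by linarith [hg (N + M)]


/-- `∑_{i<M} 1/(N+i+1)² ≤ 1/N` (`N ≥ 1`). [folklore] -/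
private theorem sum_range_inv_sq_le {N : ℕ} (hN : 1 ≤ N) (M : ℕ) :
    ∑ i ∈ Finset.range M, (((N + i + 1 : ℕ) : ℝ) ^ 2)⁻¹ ≤ ((N : ℝ))⁻¹ := by
  refine sum_range_le_of_telescope (f := fun n => ((n : ℝ) ^ 2)⁻¹) (g := fun n => ((n : ℝ))⁻¹) M
    ?_ (fun n => by positivity)
  intro n hn
  have hn1 : (1 : ℝ) ≤ n := by exact_mod_cast hN.trans hn
  push_cast
  rw [inv_eq_one_div, inv_eq_one_div, inv_eq_one_div, div_sub_div _ _ (by positivity) (by positivity),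
    div_le_div_iff₀ (by positivity) (by positivity)]
  nlinarith

/-- `∑_{i<M} 1/(N+i+1)³ ≤ 1/(2N²)` (`N ≥ 1`). [folklore] -/
private theorem sum_range_inv_cube_le {N : ℕ} (hN : 1 ≤ N) (M : ℕ) :
    ∑ i ∈ Finset.range M, (((N + i + 1 : ℕ) : ℝ) ^ 3)⁻¹ ≤ (2 * (N : ℝ) ^ 2)⁻¹ := by
  refine sum_range_le_of_telescope (f := fun n => ((n : ℝ) ^ 3)⁻¹)
    (g := fun n => (2 * (n : ℝ) ^ 2)⁻¹) M ?_ (fun n => by positivity)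
  intro n hn
  have hn1 : (1 : ℝ) ≤ n := by exact_mod_cast hN.trans hn
  push_cast
  rw [inv_eq_one_div, inv_eq_one_div, inv_eq_one_div, div_sub_div _ _ (by positivity) (by positivity),
    div_le_div_iff₀ (by positivity) (by positivity)]
  nlinarith

/-- `∑_{i<M} 1/(N+i+1)⁴ ≤ 1/(3N³)` (`N ≥ 1`). [folklore] -/
private theorem sum_range_inv_four_le {N : ℕ} (hN : 1 ≤ N) (M : ℕ) :
    ∑ i ∈ Finset.range M, (((N + i + 1 : ℕ) : ℝ) ^ 4)⁻¹ ≤ (3 * (N : ℝ) ^ 3)⁻¹ := by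
  refine sum_range_le_of_telescope (f := fun n => ((n : ℝ) ^ 4)⁻¹)
    (g := fun n => (3 * (n : ℝ) ^ 3)⁻¹) M ?_ (fun n => by positivity)
  intro n hn
  have hn1 : (1 : ℝ) ≤ n := by exact_mod_cast hN.trans hn
  push_cast
  rw [inv_eq_one_div, inv_eq_one_div, inv_eq_one_div, div_sub_div _ _ (by positivity) (by positivity),
    div_le_div_iff₀ (by positivity) (by positivity)]
  have key : (1 * (3 * ((n : ℝ) + 1) ^ 3) - 3 * (n : ℝ) ^ 3 * 1) * ((n : ℝ) + 1) ^ 4 -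
      1 * (3 * (n : ℝ) ^ 3 * (3 * ((n : ℝ) + 1) ^ 3)) =
      ((n : ℝ) + 1) ^ 3 * (18 * (n : ℝ) ^ 2 + 12 * n + 3) := by ring
  have hpos : 0 ≤ ((n : ℝ) + 1) ^ 3 * (18 * (n : ℝ) ^ 2 + 12 * n + 3) := by positivity
  linarith

/-! ### Symmetric integer ranges and evenness -/

/-- The symmetric integer range `I M = {-M, …, M}`. [folklore] -/
private def symmRange (M : ℕ) : Finset ℤ := Finset.Icc (-(M : ℤ)) M

/-- Plumbing (`mem_symmRange`). [folklore] -/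
private theorem mem_symmRange {M : ℕ} {x : ℤ} : x ∈ symmRange M ↔ -(M : ℤ) ≤ x ∧ x ≤ M := by
  simp [symmRange]

/-- Plumbing (`symmRange_succ`). [folklore] -/
private theorem symmRange_succ (M : ℕ) :
    symmRange (M + 1) = insert ((M : ℤ) + 1) (insert (-((M : ℤ) + 1)) (symmRange M)) := by
  ext x
  simp only [mem_symmRange, Finset.mem_insert, Nat.cast_add, Nat.cast_one]
  omega

/-- Plumbing (`symmRange_zero`). [folklore] -/
private theorem symmRange_zero : symmRange 0 = {0} := by
  ext x
  simp only [mem_symmRange, Finset.mem_singleton, Nat.cast_zero, neg_zero]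
  omega

/-- Plumbing (`card_symmRange`). [folklore] -/
private theorem card_symmRange (M : ℕ) : (symmRange M).card = 2 * M + 1 := by
  induction M with
  | zero => simp [symmRange_zero]
  | succ M ih =>
    rw [symmRange_succ, Finset.card_insert_of_notMem, Finset.card_insert_of_notMem, ih]
    · ring
    · simp only [mem_symmRange]; omega
    · simp only [Finset.mem_insert, mem_symmRange]; omega

/-- Evenness: `∑_{x ∈ I M} g x = g 0 + 2 ∑_{i<M} g (i+1)` for even `g`. [folklore] -/
private theorem sum_symmRange_of_even {g : ℤ → ℝ} (hg : ∀ x, g (-x) = g x) (M : ℕ) :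
    ∑ x ∈ symmRange M, g x = g 0 + 2 * ∑ i ∈ Finset.range M, g ((i : ℤ) + 1) := by
  induction M with
  | zero => simp [symmRange_zero]
  | succ M ih =>
    rw [symmRange_succ, Finset.sum_insert, Finset.sum_insert, ih, Finset.sum_range_succ, hg]
    · ring
    · simp only [mem_symmRange]; omega
    · simp only [Finset.mem_insert, mem_symmRange]; omega

/-- Plumbing (`filter_not_isOuter`). [folklore] -/
private theorem filter_not_isOuter {N M : ℕ} (h : N ≤ M) :
    (symmRange M).filter (fun x : ℤ => ¬ ((N : ℤ) < x ∨ x < -(N : ℤ))) = symmRange N := by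
  ext x
  simp only [Finset.mem_filter, mem_symmRange, not_or, not_lt]
  omega

/-- Plumbing (`filter_isOuter_self`). [folklore] -/
private theorem filter_isOuter_self (N : ℕ) : (symmRange N).filter (fun x : ℤ => (N : ℤ) < x ∨ x < -(N : ℤ)) = ∅ := by
  ext x
  simp only [Finset.mem_filter, mem_symmRange, Finset.notMem_empty, iff_false, not_and,
    not_or, not_lt]
  omega

/-- Plumbing (`filter_isOuter_succ`). [folklore] -/
private theorem filter_isOuter_succ {N M : ℕ} (h : N ≤ M) :
    (symmRange (M + 1)).filter (fun x : ℤ => (N : ℤ) < x ∨ x < -(N : ℤ)) =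
      insert ((M : ℤ) + 1) (insert (-((M : ℤ) + 1)) ((symmRange M).filter (fun x : ℤ => (N : ℤ) < x ∨ x < -(N : ℤ)))) := by
  ext x
  simp only [Finset.mem_filter, mem_symmRange, Finset.mem_insert, Nat.cast_add,
    Nat.cast_one]
  omega

/-- Evenness on the outer part: `∑_{x ∈ I M, |x| > N} g x = 2 ∑_{i < M - N} g (N+i+1)`. [folklore] -/
private theorem sum_filter_isOuter_of_even {g : ℤ → ℝ} (hg : ∀ x, g (-x) = g x) {N M : ℕ} (h : N ≤ M) :
    ∑ x ∈ (symmRange M).filter (fun x : ℤ => (N : ℤ) < x ∨ x < -(N : ℤ)), g x =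
      2 * ∑ i ∈ Finset.range (M - N), g ((N : ℤ) + i + 1) := by
  induction M, h using Nat.le_induction with
  | base => simp [filter_isOuter_self]
  | succ M hNM ih =>
    rw [filter_isOuter_succ hNM, Finset.sum_insert, Finset.sum_insert, ih,
      show M + 1 - N = (M - N) + 1 by omega, Finset.sum_range_succ, hg]
    · have : ((N : ℤ) + ((M - N : ℕ) : ℤ) + 1) = (M : ℤ) + 1 := by push_cast [Nat.cast_sub hNM]; ring
      rw [this]; ring
    · simp only [Finset.mem_filter, mem_symmRange]; omega
    · simp only [Finset.mem_insert, Finset.mem_filter, mem_symmRange]; omega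

/-- Plumbing (`isOuter_ne_zero`). [folklore] -/
private theorem isOuter_ne_zero {N : ℕ} {x : ℤ} (hx : (N : ℤ) < x ∨ x < -(N : ℤ)) : x ≠ 0 := by
  omega

/-- Plumbing (`isOuter_sq_ge`). [folklore] -/
private theorem isOuter_sq_ge {N : ℕ} {x : ℤ} (hx : (N : ℤ) < x ∨ x < -(N : ℤ)) :
    ((N : ℝ) + 1) ^ 2 ≤ (x : ℝ) ^ 2 := by
  have h : (N : ℤ) + 1 ≤ |x| := by
    rcases hx with hx | hx
    · rw [abs_of_pos (by omega)]; omega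
    · rw [abs_of_neg (by omega)]; omega
  have h' : ((N : ℝ) + 1) ≤ |(x : ℝ)| := by
    rw [← Int.cast_abs]; exact_mod_cast h
  calc ((N : ℝ) + 1) ^ 2 ≤ |(x : ℝ)| ^ 2 := by gcongr
    _ = (x : ℝ) ^ 2 := sq_abs _

/-! ### The slab decomposition of a box sum -/

/-- The triple box sum over `I M`. [folklore] -/
private def boxSum (F : ℤ → ℤ → ℤ → ℝ) (M : ℕ) : ℝ :=
  ∑ a ∈ symmRange M, ∑ b ∈ symmRange M, ∑ c ∈ symmRange M, F a b c

/-- `box(M) = box(N) + T₃ + T₂ + T₁` for `N ≤ M`. [folklore] -/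
private theorem boxSum_eq_add_slabs (F : ℤ → ℤ → ℤ → ℝ) {N M : ℕ} (h : N ≤ M) :
    boxSum F M = boxSum F N +
      (∑ a ∈ symmRange N, ∑ b ∈ symmRange N, ∑ c ∈ (symmRange M).filter (fun x : ℤ => (N : ℤ) < x ∨ x < -(N : ℤ)), F a b c) +
      (∑ a ∈ symmRange N, ∑ b ∈ (symmRange M).filter (fun x : ℤ => (N : ℤ) < x ∨ x < -(N : ℤ)), ∑ c ∈ symmRange M, F a b c) +
      (∑ a ∈ (symmRange M).filter (fun x : ℤ => (N : ℤ) < x ∨ x < -(N : ℤ)), ∑ b ∈ symmRange M, ∑ c ∈ symmRange M, F a b c) := by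
  unfold boxSum
  have split : ∀ (G : ℤ → ℝ), ∑ x ∈ symmRange M, G x =
      ∑ x ∈ symmRange N, G x + ∑ x ∈ (symmRange M).filter (fun x : ℤ => (N : ℤ) < x ∨ x < -(N : ℤ)), G x := by
    intro G
    rw [← Finset.sum_filter_add_sum_filter_not (symmRange M) (fun x : ℤ => (N : ℤ) < x ∨ x < -(N : ℤ)), filter_not_isOuter h,
      add_comm]
  rw [split]
  congr 1
  rw [← Finset.sum_add_distrib, ← Finset.sum_add_distrib]
  refine Finset.sum_congr rfl fun a _ => ?_
  rw [split]
  congr 1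
  rw [← Finset.sum_add_distrib]
  refine Finset.sum_congr rfl fun b _ => ?_
  rw [split]

/-! ### The summand `|k|⁻⁴` and its one-dimensional sections -/

/-- `q4 a b c = ((a² + b² + c²)²)⁻¹` (value `0` at the origin by `0⁻¹ = 0`). [folklore] -/
private def q4 (a b c : ℤ) : ℝ := (((a : ℝ) ^ 2 + (b : ℝ) ^ 2 + (c : ℝ) ^ 2) ^ 2)⁻¹

/-- Plumbing (`q4_nonneg`). [folklore] -/
private theorem q4_nonneg (a b c : ℤ) : 0 ≤ q4 a b c := by unfold q4; positivity

/-- Full symmetric `c`-sum of `((B + c²)²)⁻¹`: `≤ B⁻² + π/(2B√B)`. [folklore] -/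
private theorem sum_symmRange_inv_sq_add_sq_le {B : ℝ} (hB : 0 < B) (M : ℕ) :
    ∑ c ∈ symmRange M, ((B + (c : ℝ) ^ 2) ^ 2)⁻¹ ≤ (B ^ 2)⁻¹ + π / (2 * B * Real.sqrt B) := by
  rw [sum_symmRange_of_even (g := fun c : ℤ => ((B + (c : ℝ) ^ 2) ^ 2)⁻¹)
    (fun x => by simp) M]
  push_cast
  simp only [ne_eq, OfNat.ofNat_ne_zero, not_false_eq_true, zero_pow, add_zero]
  have h := sum_range_inv_sq_add_sq_le hB M
  have : 2 * ∑ i ∈ Finset.range M, ((B + ((i : ℝ) + 1) ^ 2) ^ 2)⁻¹ ≤ π / (2 * B * Real.sqrt B) := by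
    calc 2 * ∑ i ∈ Finset.range M, ((B + ((i : ℝ) + 1) ^ 2) ^ 2)⁻¹ ≤ 2 * (π / (4 * B * Real.sqrt B)) := by
          gcongr
      _ = π / (2 * B * Real.sqrt B) := by ring
  linarith

/-- Full symmetric `b`-sum of `((A + b²)√(A + b²))⁻¹`: `≤ (A√A)⁻¹ + 2/A`. [folklore] -/
private theorem sum_symmRange_inv_three_half_le {A : ℝ} (hA : 0 < A) (M : ℕ) :
    ∑ b ∈ symmRange M, ((A + (b : ℝ) ^ 2) * Real.sqrt (A + (b : ℝ) ^ 2))⁻¹ ≤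
      (A * Real.sqrt A)⁻¹ + 2 * A⁻¹ := by
  rw [sum_symmRange_of_even (g := fun b : ℤ => ((A + (b : ℝ) ^ 2) * Real.sqrt (A + (b : ℝ) ^ 2))⁻¹)
    (fun x => by simp) M]
  push_cast
  simp only [ne_eq, OfNat.ofNat_ne_zero, not_false_eq_true, zero_pow, add_zero]
  have h := sum_range_inv_three_half_le_inv hA M
  linarith

/-- Partial symmetric `a`-sum of `((A + a²)√(A + a²))⁻¹` over `I N`: `≤ (A√A)⁻¹ + 2N/(A√A)`. [folklore] -/
private theorem sum_symmRange_inv_three_half_le' {A : ℝ} (hA : 0 < A) (N : ℕ) :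
    ∑ a ∈ symmRange N, ((A + (a : ℝ) ^ 2) * Real.sqrt (A + (a : ℝ) ^ 2))⁻¹ ≤
      (2 * N + 1) * (A * Real.sqrt A)⁻¹ := by
  rw [sum_symmRange_of_even (g := fun b : ℤ => ((A + (b : ℝ) ^ 2) * Real.sqrt (A + (b : ℝ) ^ 2))⁻¹)
    (fun x => by simp) N]
  push_cast
  simp only [ne_eq, OfNat.ofNat_ne_zero, not_false_eq_true, zero_pow, add_zero]
  have h := sum_range_inv_three_half_le hA N
  have hsA : 0 < Real.sqrt A := Real.sqrt_pos.2 hA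
  have hmono : (N : ℝ) / (A * Real.sqrt (A + (N : ℝ) ^ 2)) ≤ (N : ℝ) / (A * Real.sqrt A) := by
    gcongr
    · simp
  have : 2 * ∑ i ∈ Finset.range N, ((A + ((i : ℝ) + 1) ^ 2) * Real.sqrt (A + ((i : ℝ) + 1) ^ 2))⁻¹ ≤
      2 * N * (A * Real.sqrt A)⁻¹ := by
    rw [mul_assoc, ← div_eq_mul_inv]
    gcongr
    exact h.trans hmono
  linarith

/-- The `c`-section of `q4`: for `(a, b) ≠ 0`,
`∑_{c ∈ I M} q4 a b c ≤ ((a²+b²)²)⁻¹ + π/(2(a²+b²)√(a²+b²))`. [folklore] -/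
private theorem sum_q4_c_le {a b : ℤ} (hab : 0 < (a : ℝ) ^ 2 + (b : ℝ) ^ 2) (M : ℕ) :
    ∑ c ∈ symmRange M, q4 a b c ≤ (((a : ℝ) ^ 2 + (b : ℝ) ^ 2) ^ 2)⁻¹ +
      π / (2 * ((a : ℝ) ^ 2 + (b : ℝ) ^ 2) * Real.sqrt ((a : ℝ) ^ 2 + (b : ℝ) ^ 2)) := by
  unfold q4
  exact sum_symmRange_inv_sq_add_sq_le hab M

/-- The `(b, c)`-section of `q4` for `a ≠ 0`: `∑_b ∑_c q4 a b c ≤ a⁻⁴ + π|a|⁻³ + π a⁻²`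
(written with `A = a²`, `√A = |a|`). [folklore] -/
private theorem sum_q4_bc_le {a : ℤ} (ha : a ≠ 0) (M : ℕ) :
    ∑ b ∈ symmRange M, ∑ c ∈ symmRange M, q4 a b c ≤
      (((a : ℝ) ^ 2) ^ 2)⁻¹ + π * (((a : ℝ) ^ 2) * Real.sqrt ((a : ℝ) ^ 2))⁻¹ + π * ((a : ℝ) ^ 2)⁻¹ := by
  have hA : 0 < (a : ℝ) ^ 2 := by
    have : (a : ℝ) ≠ 0 := by exact_mod_cast ha
    positivity
  set A : ℝ := (a : ℝ) ^ 2 with hAdef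
  have hsA : 0 < Real.sqrt A := Real.sqrt_pos.2 hA
  calc ∑ b ∈ symmRange M, ∑ c ∈ symmRange M, q4 a b c
      ≤ ∑ b ∈ symmRange M, (((A + (b : ℝ) ^ 2) ^ 2)⁻¹ +
          π / (2 * (A + (b : ℝ) ^ 2) * Real.sqrt (A + (b : ℝ) ^ 2))) :=
        Finset.sum_le_sum fun b _ => sum_q4_c_le (by positivity) M
    _ = ∑ b ∈ symmRange M, ((A + (b : ℝ) ^ 2) ^ 2)⁻¹ +
          (π / 2) * ∑ b ∈ symmRange M, ((A + (b : ℝ) ^ 2) * Real.sqrt (A + (b : ℝ) ^ 2))⁻¹ := by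
        rw [Finset.sum_add_distrib, Finset.mul_sum]
        congr 1
        refine Finset.sum_congr rfl fun b _ => ?_
        have : 0 < A + (b : ℝ) ^ 2 := by positivity
        have : 0 < Real.sqrt (A + (b : ℝ) ^ 2) := Real.sqrt_pos.2 this
        field_simp
    _ ≤ ((A ^ 2)⁻¹ + π / (2 * A * Real.sqrt A)) + (π / 2) * ((A * Real.sqrt A)⁻¹ + 2 * A⁻¹) := by
        gcongr
        · exact sum_symmRange_inv_sq_add_sq_le hA M
        · exact sum_symmRange_inv_three_half_le hA M
    _ = (A ^ 2)⁻¹ + π * (A * Real.sqrt A)⁻¹ + π * A⁻¹ := by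
        field_simp
        ring

/-- The `(a, c)`-section of `q4` over `a ∈ I N` for `b ≠ 0`:
`∑_{a ∈ I N} ∑_c q4 a b c ≤ (2N+1)(b⁻⁴ + (π/2)|b|⁻³)`. [folklore] -/
private theorem sum_q4_ac_le {b : ℤ} (hb : b ≠ 0) (N M : ℕ) :
    ∑ a ∈ symmRange N, ∑ c ∈ symmRange M, q4 a b c ≤
      (2 * N + 1) * ((((b : ℝ) ^ 2) ^ 2)⁻¹ + (π / 2) * (((b : ℝ) ^ 2) * Real.sqrt ((b : ℝ) ^ 2))⁻¹) := by
  have hB : 0 < (b : ℝ) ^ 2 := by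
    have : (b : ℝ) ≠ 0 := by exact_mod_cast hb
    positivity
  set A : ℝ := (b : ℝ) ^ 2 with hAdef
  have hsA : 0 < Real.sqrt A := Real.sqrt_pos.2 hB
  have hcomm : ∀ a c : ℤ, q4 a b c = (((A + (a : ℝ) ^ 2) + (c : ℝ) ^ 2) ^ 2)⁻¹ := by
    intro a c; simp only [q4, hAdef]; ring_nf
  calc ∑ a ∈ symmRange N, ∑ c ∈ symmRange M, q4 a b c
      = ∑ a ∈ symmRange N, ∑ c ∈ symmRange M, (((A + (a : ℝ) ^ 2) + (c : ℝ) ^ 2) ^ 2)⁻¹ := by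
        simp_rw [hcomm]
    _ ≤ ∑ a ∈ symmRange N, ((((A + (a : ℝ) ^ 2)) ^ 2)⁻¹ +
          π / (2 * (A + (a : ℝ) ^ 2) * Real.sqrt (A + (a : ℝ) ^ 2))) :=
        Finset.sum_le_sum fun a _ => sum_symmRange_inv_sq_add_sq_le (by positivity) M
    _ = ∑ a ∈ symmRange N, ((A + (a : ℝ) ^ 2) ^ 2)⁻¹ +
          (π / 2) * ∑ a ∈ symmRange N, ((A + (a : ℝ) ^ 2) * Real.sqrt (A + (a : ℝ) ^ 2))⁻¹ := by
        rw [Finset.sum_add_distrib, Finset.mul_sum]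
        congr 1
        refine Finset.sum_congr rfl fun a _ => ?_
        have : 0 < A + (a : ℝ) ^ 2 := by positivity
        have : 0 < Real.sqrt (A + (a : ℝ) ^ 2) := Real.sqrt_pos.2 this
        field_simp
    _ ≤ ∑ a ∈ symmRange N, (A ^ 2)⁻¹ + (π / 2) * ((2 * N + 1) * (A * Real.sqrt A)⁻¹) := by
        gcongr with a _
        · exact le_add_of_nonneg_right (sq_nonneg _)
        · exact sum_symmRange_inv_three_half_le' hB N
    _ = (2 * N + 1) * ((A ^ 2)⁻¹ + (π / 2) * (A * Real.sqrt A)⁻¹) := by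
        rw [Finset.sum_const, card_symmRange, nsmul_eq_mul]
        push_cast
        ring

/-! ### The three slabs -/

/-- `T₃ ≤ (2N+1)² · 2/(3N³)`. [folklore] -/
private theorem slab3_le {N M : ℕ} (hN : 1 ≤ N) (h : N ≤ M) :
    ∑ a ∈ symmRange N, ∑ b ∈ symmRange N, ∑ c ∈ (symmRange M).filter (fun x : ℤ => (N : ℤ) < x ∨ x < -(N : ℤ)), q4 a b c ≤
      (2 * (N : ℝ) + 1) ^ 2 * (2 * (3 * (N : ℝ) ^ 3)⁻¹) := by
  have hinner : ∀ a b : ℤ, ∑ c ∈ (symmRange M).filter (fun x : ℤ => (N : ℤ) < x ∨ x < -(N : ℤ)), q4 a b c ≤ 2 * (3 * (N : ℝ) ^ 3)⁻¹ := by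
    intro a b
    calc ∑ c ∈ (symmRange M).filter (fun x : ℤ => (N : ℤ) < x ∨ x < -(N : ℤ)), q4 a b c
        ≤ ∑ c ∈ (symmRange M).filter (fun x : ℤ => (N : ℤ) < x ∨ x < -(N : ℤ)), (((c : ℝ) ^ 2) ^ 2)⁻¹ := by
          refine Finset.sum_le_sum fun c hc => ?_
          have hc0 : c ≠ 0 := isOuter_ne_zero (Finset.mem_filter.1 hc).2
          have hc' : (c : ℝ) ≠ 0 := by exact_mod_cast hc0
          unfold q4
          refine inv_anti₀ (by positivity) ?_
          gcongr
          nlinarith [sq_nonneg (a : ℝ), sq_nonneg (b : ℝ)]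
      _ = 2 * ∑ i ∈ Finset.range (M - N), ((((N : ℝ) + i + 1) ^ 2) ^ 2)⁻¹ := by
          rw [sum_filter_isOuter_of_even (g := fun c : ℤ => (((c : ℝ) ^ 2) ^ 2)⁻¹) (fun x => by simp) h]
          push_cast
          rfl
      _ ≤ 2 * (3 * (N : ℝ) ^ 3)⁻¹ := by
          have hP := sum_range_inv_four_le hN (M - N)
          push_cast at hP
          have : ∑ i ∈ Finset.range (M - N), ((((N : ℝ) + i + 1) ^ 2) ^ 2)⁻¹ =
              ∑ i ∈ Finset.range (M - N), (((N : ℝ) + i + 1) ^ 4)⁻¹ :=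
            Finset.sum_congr rfl fun i _ => by ring
          rw [this]
          linarith
  calc ∑ a ∈ symmRange N, ∑ b ∈ symmRange N, ∑ c ∈ (symmRange M).filter (fun x : ℤ => (N : ℤ) < x ∨ x < -(N : ℤ)), q4 a b c
      ≤ ∑ a ∈ symmRange N, ∑ b ∈ symmRange N, 2 * (3 * (N : ℝ) ^ 3)⁻¹ :=
        Finset.sum_le_sum fun a _ => Finset.sum_le_sum fun b _ => hinner a b
    _ = (2 * (N : ℝ) + 1) ^ 2 * (2 * (3 * (N : ℝ) ^ 3)⁻¹) := by
        rw [Finset.sum_const, Finset.sum_const, card_symmRange, nsmul_eq_mul, nsmul_eq_mul]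
        push_cast
        ring

/-- `T₂ ≤ 2(2N+1)(1/(3N³) + (π/2)/(2N²))`. [folklore] -/
private theorem slab2_le {N M : ℕ} (hN : 1 ≤ N) (h : N ≤ M) :
    ∑ a ∈ symmRange N, ∑ b ∈ (symmRange M).filter (fun x : ℤ => (N : ℤ) < x ∨ x < -(N : ℤ)), ∑ c ∈ symmRange M, q4 a b c ≤
      2 * (2 * (N : ℝ) + 1) * ((3 * (N : ℝ) ^ 3)⁻¹ + (π / 2) * (2 * (N : ℝ) ^ 2)⁻¹) := by
  rw [Finset.sum_comm]
  set g : ℤ → ℝ := fun b => (2 * N + 1) * ((((b : ℝ) ^ 2) ^ 2)⁻¹ +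
    (π / 2) * (((b : ℝ) ^ 2) * Real.sqrt ((b : ℝ) ^ 2))⁻¹) with hg
  have hgeven : ∀ x, g (-x) = g x := fun x => by simp [hg]
  calc ∑ b ∈ (symmRange M).filter (fun x : ℤ => (N : ℤ) < x ∨ x < -(N : ℤ)), ∑ a ∈ symmRange N, ∑ c ∈ symmRange M, q4 a b c
      ≤ ∑ b ∈ (symmRange M).filter (fun x : ℤ => (N : ℤ) < x ∨ x < -(N : ℤ)), g b :=
        Finset.sum_le_sum fun b hb => sum_q4_ac_le (isOuter_ne_zero (Finset.mem_filter.1 hb).2) N M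
    _ = 2 * ∑ i ∈ Finset.range (M - N), g ((N : ℤ) + i + 1) := sum_filter_isOuter_of_even hgeven h
    _ = 2 * ((2 * N + 1) * ∑ i ∈ Finset.range (M - N),
          ((((N : ℝ) + i + 1) ^ 4)⁻¹ + (π / 2) * (((N : ℝ) + i + 1) ^ 3)⁻¹)) := by
        congr 1
        rw [Finset.mul_sum]
        refine Finset.sum_congr rfl fun i _ => ?_
        simp only [hg]
        push_cast
        rw [Real.sqrt_sq (by positivity)]
        ring
    _ ≤ 2 * ((2 * N + 1) * ((3 * (N : ℝ) ^ 3)⁻¹ + (π / 2) * (2 * (N : ℝ) ^ 2)⁻¹)) := by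
        have h4 := sum_range_inv_four_le hN (M - N)
        have h3 := sum_range_inv_cube_le hN (M - N)
        push_cast at h4 h3
        rw [Finset.sum_add_distrib, ← Finset.mul_sum]
        gcongr
    _ = 2 * (2 * (N : ℝ) + 1) * ((3 * (N : ℝ) ^ 3)⁻¹ + (π / 2) * (2 * (N : ℝ) ^ 2)⁻¹) := by ring

/-- `T₁ ≤ 2(1/(3N³) + π/(2N²) + π/N)`. [folklore] -/
private theorem slab1_le {N M : ℕ} (hN : 1 ≤ N) (h : N ≤ M) :
    ∑ a ∈ (symmRange M).filter (fun x : ℤ => (N : ℤ) < x ∨ x < -(N : ℤ)), ∑ b ∈ symmRange M, ∑ c ∈ symmRange M, q4 a b c ≤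
      2 * ((3 * (N : ℝ) ^ 3)⁻¹ + π * (2 * (N : ℝ) ^ 2)⁻¹ + π * (N : ℝ)⁻¹) := by
  set g : ℤ → ℝ := fun a => (((a : ℝ) ^ 2) ^ 2)⁻¹ +
    π * (((a : ℝ) ^ 2) * Real.sqrt ((a : ℝ) ^ 2))⁻¹ + π * ((a : ℝ) ^ 2)⁻¹ with hg
  have hgeven : ∀ x, g (-x) = g x := fun x => by simp [hg]
  calc ∑ a ∈ (symmRange M).filter (fun x : ℤ => (N : ℤ) < x ∨ x < -(N : ℤ)), ∑ b ∈ symmRange M, ∑ c ∈ symmRange M, q4 a b c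
      ≤ ∑ a ∈ (symmRange M).filter (fun x : ℤ => (N : ℤ) < x ∨ x < -(N : ℤ)), g a :=
        Finset.sum_le_sum fun a ha => sum_q4_bc_le (isOuter_ne_zero (Finset.mem_filter.1 ha).2) M
    _ = 2 * ∑ i ∈ Finset.range (M - N), g ((N : ℤ) + i + 1) := sum_filter_isOuter_of_even hgeven h
    _ = 2 * ∑ i ∈ Finset.range (M - N),
          ((((N : ℝ) + i + 1) ^ 4)⁻¹ + π * (((N : ℝ) + i + 1) ^ 3)⁻¹ + π * (((N : ℝ) + i + 1) ^ 2)⁻¹) := by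
        congr 1
        refine Finset.sum_congr rfl fun i _ => ?_
        simp only [hg]
        push_cast
        rw [Real.sqrt_sq (by positivity)]
        ring
    _ ≤ 2 * ((3 * (N : ℝ) ^ 3)⁻¹ + π * (2 * (N : ℝ) ^ 2)⁻¹ + π * (N : ℝ)⁻¹) := by
        have h4 := sum_range_inv_four_le hN (M - N)
        have h3 := sum_range_inv_cube_le hN (M - N)
        have h2 := sum_range_inv_sq_le hN (M - N)
        push_cast at h4 h3 h2
        rw [Finset.sum_add_distrib, Finset.sum_add_distrib, ← Finset.mul_sum, ← Finset.mul_sum]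
        gcongr

/-- The explicit tail majorant `τ(N)`. [folklore] -/
private def tail4 (N : ℕ) : ℝ :=
  2 * ((3 * (N : ℝ) ^ 3)⁻¹ + π * (2 * (N : ℝ) ^ 2)⁻¹ + π * (N : ℝ)⁻¹) +
  2 * (2 * (N : ℝ) + 1) * ((3 * (N : ℝ) ^ 3)⁻¹ + (π / 2) * (2 * (N : ℝ) ^ 2)⁻¹) +
  (2 * (N : ℝ) + 1) ^ 2 * (2 * (3 * (N : ℝ) ^ 3)⁻¹)

/-- Plumbing (`tail4_nonneg`). [folklore] -/
private theorem tail4_nonneg (N : ℕ) : 0 ≤ tail4 N := by unfold tail4; positivity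

/-- Monotonicity of the box sums in `M`. [folklore] -/
private theorem boxSum_q4_mono {M N : ℕ} (h : M ≤ N) : boxSum q4 M ≤ boxSum q4 N := by
  unfold boxSum
  have hsub : symmRange M ⊆ symmRange N := by
    intro x hx; rw [mem_symmRange] at hx ⊢; omega
  calc ∑ a ∈ symmRange M, ∑ b ∈ symmRange M, ∑ c ∈ symmRange M, q4 a b c
      ≤ ∑ a ∈ symmRange M, ∑ b ∈ symmRange M, ∑ c ∈ symmRange N, q4 a b c :=
        Finset.sum_le_sum fun a _ => Finset.sum_le_sum fun b _ =>
          Finset.sum_le_sum_of_subset_of_nonneg hsub fun c _ _ => q4_nonneg a b c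
    _ ≤ ∑ a ∈ symmRange M, ∑ b ∈ symmRange N, ∑ c ∈ symmRange N, q4 a b c :=
        Finset.sum_le_sum fun a _ => Finset.sum_le_sum_of_subset_of_nonneg hsub fun b _ _ =>
          Finset.sum_nonneg fun c _ => q4_nonneg a b c
    _ ≤ ∑ a ∈ symmRange N, ∑ b ∈ symmRange N, ∑ c ∈ symmRange N, q4 a b c :=
        Finset.sum_le_sum_of_subset_of_nonneg hsub fun a _ _ =>
          Finset.sum_nonneg fun b _ => Finset.sum_nonneg fun c _ => q4_nonneg a b c

/-- **Box sums are controlled by one box plus the explicit tail**: `box(M) ≤ box(N) + τ(N)`. [folklore] -/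
private theorem boxSum_q4_le (N : ℕ) (hN : 1 ≤ N) (M : ℕ) : boxSum q4 M ≤ boxSum q4 N + tail4 N := by
  rcases le_total M N with h | h
  · exact (boxSum_q4_mono h).trans (le_add_of_nonneg_right (tail4_nonneg N))
  · rw [boxSum_eq_add_slabs q4 h, tail4]
    have h1 := slab1_le hN h
    have h2 := slab2_le hN h
    have h3 := slab3_le hN h
    linarith

/-! ### The finite certificate -/

/-- Ceiling division `⌈x/y⌉` on `ℕ` (`0` for `y = 0`). [folklore] -/
private def ceilDiv (x y : ℕ) : ℕ := (x + y - 1) / y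

/-- Plumbing (`le_ceilDiv_mul`). [folklore] -/
private theorem le_ceilDiv_mul (x : ℕ) {y : ℕ} (hy : 0 < y) : x ≤ ceilDiv x y * y := by
  unfold ceilDiv
  have h := Nat.lt_div_mul_add (a := x + y - 1) hy
  generalize (x + y - 1) / y * y = r at h ⊢
  omega

/-- `1/m² ≤ ⌈P/m²⌉/P` (also for `m = 0`, where the left side is `0`). [folklore] -/
private theorem inv_sq_le_ceilDiv {P : ℕ} (hP : 0 < P) (m : ℕ) :
    (((m : ℝ)) ^ 2)⁻¹ ≤ (ceilDiv P (m ^ 2) : ℝ) / P := by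
  rcases Nat.eq_zero_or_pos m with hm | hm
  · subst hm; simp; positivity
  · have hy : 0 < m ^ 2 := by positivity
    have h := le_ceilDiv_mul P hy
    have hPr : (0 : ℝ) < P := by exact_mod_cast hP
    have hyr : (0 : ℝ) < (m : ℝ) ^ 2 := by positivity
    rw [inv_eq_one_div, div_le_div_iff₀ hyr hPr, one_mul]
    exact_mod_cast h

/-- The symmetric range as a shifted `range`. [folklore] -/
private theorem sum_symmRange_eq_sum_range (g : ℤ → ℝ) (N : ℕ) :
    ∑ x ∈ symmRange N, g x = ∑ i ∈ Finset.range (2 * N + 1), g ((i : ℤ) - N) := by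
  have hS : symmRange N = (Finset.range (2 * N + 1)).image (fun i : ℕ => (i : ℤ) - N) := by
    ext x
    simp only [mem_symmRange, Finset.mem_image, Finset.mem_range]
    constructor
    · intro hx; exact ⟨(x + N).toNat, by omega, by omega⟩
    · rintro ⟨i, hi, rfl⟩; omega
  rw [hS, Finset.sum_image]
  intro i _ j _ hij
  have : (i : ℤ) = j := by
    have := hij; simp only at this; linarith
  exact_mod_cast this

/-- The per-term certificate bound. [folklore] -/
private theorem q4_le_ceilDiv {P : ℕ} (hP : 0 < P) (a b c : ℤ) :
    q4 a b c ≤ (ceilDiv P ((a ^ 2 + b ^ 2 + c ^ 2).toNat ^ 2) : ℝ) / P := by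
  have hs : 0 ≤ a ^ 2 + b ^ 2 + c ^ 2 := by positivity
  have hcast : ((a : ℝ) ^ 2 + (b : ℝ) ^ 2 + (c : ℝ) ^ 2) = (((a ^ 2 + b ^ 2 + c ^ 2).toNat : ℕ) : ℝ) := by
    have h1 : (((a ^ 2 + b ^ 2 + c ^ 2).toNat : ℕ) : ℤ) = a ^ 2 + b ^ 2 + c ^ 2 := Int.toNat_of_nonneg hs
    have h2 : (((a ^ 2 + b ^ 2 + c ^ 2).toNat : ℕ) : ℝ) = (((a ^ 2 + b ^ 2 + c ^ 2 : ℤ)) : ℝ) := by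
      exact_mod_cast h1
    rw [h2]; push_cast; ring
  unfold q4
  rw [hcast]
  exact inv_sq_le_ceilDiv hP _

/-- The kernel-evaluable box sum of ceilings. [folklore] -/
private def boxNat4 (P N : ℕ) : ℕ :=
  ∑ i ∈ Finset.range (2 * N + 1), ∑ j ∈ Finset.range (2 * N + 1), ∑ l ∈ Finset.range (2 * N + 1),
    ceilDiv P ((((i : ℤ) - N) ^ 2 + ((j : ℤ) - N) ^ 2 + ((l : ℤ) - N) ^ 2).toNat ^ 2)

/-- Plumbing (`boxSum_q4_le_boxNat4`). [folklore] -/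
private theorem boxSum_q4_le_boxNat4 {P : ℕ} (hP : 0 < P) (N : ℕ) :
    boxSum q4 N ≤ (boxNat4 P N : ℝ) / P := by
  unfold boxSum boxNat4
  simp only [sum_symmRange_eq_sum_range]
  push_cast
  simp_rw [Finset.sum_div]
  gcongr with i _ j _ l _
  exact q4_le_ceilDiv hP _ _ _

set_option maxRecDepth 100000 in
/-- The certificate at `N = 25`, `P = 10⁸`: `∑_{‖k‖∞ ≤ 25, k ≠ 0} ⌈10⁸/|k|⁴⌉ = 1612342642`
(kernel evaluation). [folklore] -/
private theorem boxNat4_25 : boxNat4 (10 ^ 8) 25 = 1612342642 := by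
  decide +kernel

/-- `box(25) ≤ 16.12342642`. [folklore] -/
private theorem boxSum_q4_25_le : boxSum q4 25 ≤ 16.12342642 := by
  have h := boxSum_q4_le_boxNat4 (P := 10 ^ 8) (by norm_num) 25
  rw [boxNat4_25] at h
  norm_num at h ⊢
  linarith

/-! ### The lattice sum `∑' |k|⁻⁴` over `ℤ³` -/

/-- `|k|⁻⁴` on `ℤ × ℤ × ℤ`. [folklore] -/
private def Q4 (p : ℤ × ℤ × ℤ) : ℝ := q4 p.1 p.2.1 p.2.2

/-- Plumbing (`Q4_nonneg`). [folklore] -/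
private theorem Q4_nonneg (p : ℤ × ℤ × ℤ) : 0 ≤ Q4 p := q4_nonneg _ _ _

/-- Plumbing (`boxSum_eq_sum_cube`). [folklore] -/
private theorem boxSum_eq_sum_cube (F : ℤ → ℤ → ℤ → ℝ) (M : ℕ) :
    boxSum F M = ∑ p ∈ symmRange M ×ˢ (symmRange M ×ˢ symmRange M), F p.1 p.2.1 p.2.2 := by
  rw [boxSum, Finset.sum_product]
  refine Finset.sum_congr rfl fun a _ => ?_
  rw [Finset.sum_product]

/-- Every finite set of lattice points lies in some cube. [folklore] -/
private theorem exists_subset_cube (u : Finset (ℤ × ℤ × ℤ)) :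
    ∃ M : ℕ, u ⊆ symmRange M ×ˢ (symmRange M ×ˢ symmRange M) := by
  refine ⟨u.sup fun p => (|p.1| ⊔ (|p.2.1| ⊔ |p.2.2|)).toNat, fun p hp => ?_⟩
  have hle : (|p.1| ⊔ (|p.2.1| ⊔ |p.2.2|)).toNat ≤ u.sup fun p => (|p.1| ⊔ (|p.2.1| ⊔ |p.2.2|)).toNat :=
    Finset.le_sup (f := fun p : ℤ × ℤ × ℤ => (|p.1| ⊔ (|p.2.1| ⊔ |p.2.2|)).toNat) hp
  set M := u.sup fun p => (|p.1| ⊔ (|p.2.1| ⊔ |p.2.2|)).toNat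
  have h' : |p.1| ⊔ (|p.2.1| ⊔ |p.2.2|) ≤ (M : ℤ) := Int.toNat_le.1 hle
  have h1 : |p.1| ≤ M := le_trans le_sup_left h'
  have h2 : |p.2.1| ≤ M := le_trans (le_trans le_sup_left le_sup_right) h'
  have h3 : |p.2.2| ≤ M := le_trans (le_trans le_sup_right le_sup_right) h'
  simp only [Finset.mem_product, mem_symmRange]
  exact ⟨abs_le.1 h1, abs_le.1 h2, abs_le.1 h3⟩

/-- Plumbing (`sum_Q4_le`). [folklore] -/
private theorem sum_Q4_le (u : Finset (ℤ × ℤ × ℤ)) : ∑ p ∈ u, Q4 p ≤ boxSum q4 25 + tail4 25 := by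
  obtain ⟨M, hM⟩ := exists_subset_cube u
  calc ∑ p ∈ u, Q4 p ≤ ∑ p ∈ symmRange M ×ˢ (symmRange M ×ˢ symmRange M), Q4 p :=
        Finset.sum_le_sum_of_subset_of_nonneg hM fun p _ _ => Q4_nonneg p
    _ = boxSum q4 M := (boxSum_eq_sum_cube q4 M).symm
    _ ≤ boxSum q4 25 + tail4 25 := boxSum_q4_le 25 (by norm_num) M

/-- Plumbing (`summable_Q4`). [folklore] -/
private theorem summable_Q4 : Summable Q4 := summable_of_sum_le Q4_nonneg sum_Q4_le

/-- Plumbing (`tail4_25_le`). [folklore] -/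
private theorem tail4_25_le : tail4 25 ≤ 0.4978 := by
  have hπ := Real.pi_lt_d6
  unfold tail4
  norm_num
  nlinarith [hπ, Real.pi_pos]

/-- **Upper enclosure**: `∑'_{k ∈ ℤ³} |k|⁻⁴ ≤ 16.6213`. [folklore] -/
private theorem tsum_Q4_le : ∑' p, Q4 p ≤ 16.6213 := by
  have h := Real.tsum_le_of_sum_le Q4_nonneg sum_Q4_le
  linarith [boxSum_q4_25_le, tail4_25_le]

/-- **Lower enclosure**: `16.12 ≤ ∑'_{k ∈ ℤ³} |k|⁻⁴`. [folklore] -/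
private theorem le_tsum_Q4 : boxSum q4 25 ≤ ∑' p, Q4 p := by
  rw [boxSum_eq_sum_cube]
  exact summable_Q4.sum_le_tsum _ (fun p _ => Q4_nonneg p)

/-! ### Lower certificate -/

/-- Plumbing (`floorDiv_le_inv_sq`). [folklore] -/
private theorem floorDiv_le_inv_sq {P : ℕ} (hP : 0 < P) (m : ℕ) :
    ((P / m ^ 2 : ℕ) : ℝ) / P ≤ (((m : ℝ)) ^ 2)⁻¹ := by
  rcases Nat.eq_zero_or_pos m with hm | hm
  · subst hm; simp
  · have hy : 0 < m ^ 2 := by positivity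
    have h := Nat.div_mul_le_self P (m ^ 2)
    have hPr : (0 : ℝ) < P := by exact_mod_cast hP
    have hyr : (0 : ℝ) < (m : ℝ) ^ 2 := by positivity
    rw [inv_eq_one_div, div_le_div_iff₀ hPr hyr, one_mul]
    exact_mod_cast h

/-- Plumbing (`floorDiv_le_q4`). [folklore] -/
private theorem floorDiv_le_q4 {P : ℕ} (hP : 0 < P) (a b c : ℤ) :
    ((P / ((a ^ 2 + b ^ 2 + c ^ 2).toNat ^ 2) : ℕ) : ℝ) / P ≤ q4 a b c := by
  have hs : 0 ≤ a ^ 2 + b ^ 2 + c ^ 2 := by positivity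
  have hcast : ((a : ℝ) ^ 2 + (b : ℝ) ^ 2 + (c : ℝ) ^ 2) = (((a ^ 2 + b ^ 2 + c ^ 2).toNat : ℕ) : ℝ) := by
    have h1 : (((a ^ 2 + b ^ 2 + c ^ 2).toNat : ℕ) : ℤ) = a ^ 2 + b ^ 2 + c ^ 2 := Int.toNat_of_nonneg hs
    have h2 : (((a ^ 2 + b ^ 2 + c ^ 2).toNat : ℕ) : ℝ) = (((a ^ 2 + b ^ 2 + c ^ 2 : ℤ)) : ℝ) := by
      exact_mod_cast h1
    rw [h2]; push_cast; ring
  unfold q4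
  rw [hcast]
  exact floorDiv_le_inv_sq hP _

/-- Plumbing (`boxNat4Floor`). [folklore] -/
private def boxNat4Floor (P N : ℕ) : ℕ :=
  ∑ i ∈ Finset.range (2 * N + 1), ∑ j ∈ Finset.range (2 * N + 1), ∑ l ∈ Finset.range (2 * N + 1),
    P / ((((i : ℤ) - N) ^ 2 + ((j : ℤ) - N) ^ 2 + ((l : ℤ) - N) ^ 2).toNat ^ 2)

/-- Plumbing (`boxNat4Floor_le_boxSum_q4`). [folklore] -/
private theorem boxNat4Floor_le_boxSum_q4 {P : ℕ} (hP : 0 < P) (N : ℕ) :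
    (boxNat4Floor P N : ℝ) / P ≤ boxSum q4 N := by
  unfold boxSum boxNat4Floor
  simp only [sum_symmRange_eq_sum_range]
  push_cast
  simp_rw [Finset.sum_div]
  gcongr with i _ j _ l _
  exact floorDiv_le_q4 hP _ _ _

set_option maxRecDepth 100000 in
/-- Plumbing (`boxNat4Floor_25`). [folklore] -/
private theorem boxNat4Floor_25 : boxNat4Floor (10 ^ 8) 25 = 1612211150 := by
  decide +kernel

/-- Plumbing (`le_boxSum_q4_25`). [folklore] -/
private theorem le_boxSum_q4_25 : (16.1221115 : ℝ) ≤ boxSum q4 25 := by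
  have h := boxNat4Floor_le_boxSum_q4 (P := 10 ^ 8) (by norm_num) 25
  rw [boxNat4Floor_25] at h
  norm_num at h ⊢
  linarith

/-- Plumbing (`le_tsum_Q4'`). [folklore] -/
private theorem le_tsum_Q4' : (16.1221115 : ℝ) ≤ ∑' p, Q4 p := le_boxSum_q4_25.trans le_tsum_Q4

/-! ### The lattice sum `∑' |k|⁻⁶` -/

/-- `q6 a b c = ((a² + b² + c²)³)⁻¹`. [folklore] -/
private def q6 (a b c : ℤ) : ℝ := (((a : ℝ) ^ 2 + (b : ℝ) ^ 2 + (c : ℝ) ^ 2) ^ 3)⁻¹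

/-- Plumbing (`q6_nonneg`). [folklore] -/
private theorem q6_nonneg (a b c : ℤ) : 0 ≤ q6 a b c := by unfold q6; positivity

/-- On a slab, `q6 ≤ q4/(N+1)²`. [folklore] -/
private theorem q6_le_q4_of_sq_ge {N : ℕ} {a b c : ℤ} (h : ((N : ℝ) + 1) ^ 2 ≤ (a : ℝ) ^ 2 + (b : ℝ) ^ 2 + (c : ℝ) ^ 2) :
    q6 a b c ≤ (((N : ℝ) + 1) ^ 2)⁻¹ * q4 a b c := by
  unfold q6 q4
  set s : ℝ := (a : ℝ) ^ 2 + (b : ℝ) ^ 2 + (c : ℝ) ^ 2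
  have hs : 0 < s := lt_of_lt_of_le (by positivity) h
  rw [show (s ^ 3)⁻¹ = s⁻¹ * (s ^ 2)⁻¹ by rw [← mul_inv, ← pow_succ']]
  gcongr

/-- Plumbing (`isOuter_sq_ge₁`). [folklore] -/
private theorem isOuter_sq_ge₁ {N : ℕ} {a : ℤ} (ha : (N : ℤ) < a ∨ a < -(N : ℤ)) (b c : ℤ) :
    ((N : ℝ) + 1) ^ 2 ≤ (a : ℝ) ^ 2 + (b : ℝ) ^ 2 + (c : ℝ) ^ 2 := by
  nlinarith [isOuter_sq_ge ha, sq_nonneg (b : ℝ), sq_nonneg (c : ℝ)]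

/-- Plumbing (`isOuter_sq_ge₂`). [folklore] -/
private theorem isOuter_sq_ge₂ {N : ℕ} {b : ℤ} (hb : (N : ℤ) < b ∨ b < -(N : ℤ)) (a c : ℤ) :
    ((N : ℝ) + 1) ^ 2 ≤ (a : ℝ) ^ 2 + (b : ℝ) ^ 2 + (c : ℝ) ^ 2 := by
  nlinarith [isOuter_sq_ge hb, sq_nonneg (a : ℝ), sq_nonneg (c : ℝ)]

/-- Plumbing (`isOuter_sq_ge₃`). [folklore] -/
private theorem isOuter_sq_ge₃ {N : ℕ} {c : ℤ} (hc : (N : ℤ) < c ∨ c < -(N : ℤ)) (a b : ℤ) :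
    ((N : ℝ) + 1) ^ 2 ≤ (a : ℝ) ^ 2 + (b : ℝ) ^ 2 + (c : ℝ) ^ 2 := by
  nlinarith [isOuter_sq_ge hc, sq_nonneg (a : ℝ), sq_nonneg (b : ℝ)]

/-- Plumbing (`boxSum_mono`). [folklore] -/
private theorem boxSum_mono {F : ℤ → ℤ → ℤ → ℝ} (hF : ∀ a b c, 0 ≤ F a b c) {M N : ℕ} (h : M ≤ N) :
    boxSum F M ≤ boxSum F N := by
  unfold boxSum
  have hsub : symmRange M ⊆ symmRange N := by
    intro x hx; rw [mem_symmRange] at hx ⊢; omega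
  calc ∑ a ∈ symmRange M, ∑ b ∈ symmRange M, ∑ c ∈ symmRange M, F a b c
      ≤ ∑ a ∈ symmRange M, ∑ b ∈ symmRange M, ∑ c ∈ symmRange N, F a b c :=
        Finset.sum_le_sum fun a _ => Finset.sum_le_sum fun b _ =>
          Finset.sum_le_sum_of_subset_of_nonneg hsub fun c _ _ => hF a b c
    _ ≤ ∑ a ∈ symmRange M, ∑ b ∈ symmRange N, ∑ c ∈ symmRange N, F a b c :=
        Finset.sum_le_sum fun a _ => Finset.sum_le_sum_of_subset_of_nonneg hsub fun b _ _ =>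
          Finset.sum_nonneg fun c _ => hF a b c
    _ ≤ ∑ a ∈ symmRange N, ∑ b ∈ symmRange N, ∑ c ∈ symmRange N, F a b c :=
        Finset.sum_le_sum_of_subset_of_nonneg hsub fun a _ _ =>
          Finset.sum_nonneg fun b _ => Finset.sum_nonneg fun c _ => hF a b c

/-- `box₆(M) ≤ box₆(N) + τ(N)/(N+1)²`. [folklore] -/
private theorem boxSum_q6_le (N : ℕ) (hN : 1 ≤ N) (M : ℕ) :
    boxSum q6 M ≤ boxSum q6 N + (((N : ℝ) + 1) ^ 2)⁻¹ * tail4 N := by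
  rcases le_total M N with h | h
  · exact (boxSum_mono q6_nonneg h).trans
      (le_add_of_nonneg_right (mul_nonneg (by positivity) (tail4_nonneg N)))
  · rw [boxSum_eq_add_slabs q6 h]
    have h1 := slab1_le hN h
    have h2 := slab2_le hN h
    have h3 := slab3_le hN h
    set K : ℝ := (((N : ℝ) + 1) ^ 2)⁻¹
    have hK : 0 ≤ K := by positivity
    -- compare each slab of `q6` with `K` times the slab of `q4`
    have e3 : ∑ a ∈ symmRange N, ∑ b ∈ symmRange N, ∑ c ∈ (symmRange M).filter (fun x : ℤ => (N : ℤ) < x ∨ x < -(N : ℤ)), q6 a b c ≤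
        K * ∑ a ∈ symmRange N, ∑ b ∈ symmRange N, ∑ c ∈ (symmRange M).filter (fun x : ℤ => (N : ℤ) < x ∨ x < -(N : ℤ)), q4 a b c := by
      rw [Finset.mul_sum]
      refine Finset.sum_le_sum fun a _ => ?_
      rw [Finset.mul_sum]
      refine Finset.sum_le_sum fun b _ => ?_
      rw [Finset.mul_sum]
      refine Finset.sum_le_sum fun c hc => ?_
      exact q6_le_q4_of_sq_ge (isOuter_sq_ge₃ (Finset.mem_filter.1 hc).2 a b)
    have e2 : ∑ a ∈ symmRange N, ∑ b ∈ (symmRange M).filter (fun x : ℤ => (N : ℤ) < x ∨ x < -(N : ℤ)), ∑ c ∈ symmRange M, q6 a b c ≤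
        K * ∑ a ∈ symmRange N, ∑ b ∈ (symmRange M).filter (fun x : ℤ => (N : ℤ) < x ∨ x < -(N : ℤ)), ∑ c ∈ symmRange M, q4 a b c := by
      rw [Finset.mul_sum]
      refine Finset.sum_le_sum fun a _ => ?_
      rw [Finset.mul_sum]
      refine Finset.sum_le_sum fun b hb => ?_
      rw [Finset.mul_sum]
      refine Finset.sum_le_sum fun c _ => ?_
      exact q6_le_q4_of_sq_ge (isOuter_sq_ge₂ (Finset.mem_filter.1 hb).2 a c)
    have e1 : ∑ a ∈ (symmRange M).filter (fun x : ℤ => (N : ℤ) < x ∨ x < -(N : ℤ)), ∑ b ∈ symmRange M, ∑ c ∈ symmRange M, q6 a b c ≤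
        K * ∑ a ∈ (symmRange M).filter (fun x : ℤ => (N : ℤ) < x ∨ x < -(N : ℤ)), ∑ b ∈ symmRange M, ∑ c ∈ symmRange M, q4 a b c := by
      rw [Finset.mul_sum]
      refine Finset.sum_le_sum fun a ha => ?_
      rw [Finset.mul_sum]
      refine Finset.sum_le_sum fun b _ => ?_
      rw [Finset.mul_sum]
      refine Finset.sum_le_sum fun c _ => ?_
      exact q6_le_q4_of_sq_ge (isOuter_sq_ge₁ (Finset.mem_filter.1 ha).2 b c)
    have : K * (∑ a ∈ symmRange N, ∑ b ∈ symmRange N, ∑ c ∈ (symmRange M).filter (fun x : ℤ => (N : ℤ) < x ∨ x < -(N : ℤ)), q4 a b c) +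
        K * (∑ a ∈ symmRange N, ∑ b ∈ (symmRange M).filter (fun x : ℤ => (N : ℤ) < x ∨ x < -(N : ℤ)), ∑ c ∈ symmRange M, q4 a b c) +
        K * (∑ a ∈ (symmRange M).filter (fun x : ℤ => (N : ℤ) < x ∨ x < -(N : ℤ)), ∑ b ∈ symmRange M, ∑ c ∈ symmRange M, q4 a b c) ≤
        K * tail4 N := by
      rw [← mul_add, ← mul_add, tail4]
      exact mul_le_mul_of_nonneg_left (by linarith) hK
    linarith

/-- Plumbing (`inv_cube_le_ceilDiv`). [folklore] -/
private theorem inv_cube_le_ceilDiv {P : ℕ} (hP : 0 < P) (m : ℕ) :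
    (((m : ℝ)) ^ 3)⁻¹ ≤ (ceilDiv P (m ^ 3) : ℝ) / P := by
  rcases Nat.eq_zero_or_pos m with hm | hm
  · subst hm; simp; positivity
  · have hy : 0 < m ^ 3 := by positivity
    have h := le_ceilDiv_mul P hy
    have hPr : (0 : ℝ) < P := by exact_mod_cast hP
    have hyr : (0 : ℝ) < (m : ℝ) ^ 3 := by positivity
    rw [inv_eq_one_div, div_le_div_iff₀ hyr hPr, one_mul]
    exact_mod_cast h

/-- Plumbing (`q6_le_ceilDiv`). [folklore] -/
private theorem q6_le_ceilDiv {P : ℕ} (hP : 0 < P) (a b c : ℤ) :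
    q6 a b c ≤ (ceilDiv P ((a ^ 2 + b ^ 2 + c ^ 2).toNat ^ 3) : ℝ) / P := by
  have hs : 0 ≤ a ^ 2 + b ^ 2 + c ^ 2 := by positivity
  have hcast : ((a : ℝ) ^ 2 + (b : ℝ) ^ 2 + (c : ℝ) ^ 2) = (((a ^ 2 + b ^ 2 + c ^ 2).toNat : ℕ) : ℝ) := by
    have h1 : (((a ^ 2 + b ^ 2 + c ^ 2).toNat : ℕ) : ℤ) = a ^ 2 + b ^ 2 + c ^ 2 := Int.toNat_of_nonneg hs
    have h2 : (((a ^ 2 + b ^ 2 + c ^ 2).toNat : ℕ) : ℝ) = (((a ^ 2 + b ^ 2 + c ^ 2 : ℤ)) : ℝ) := by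
      exact_mod_cast h1
    rw [h2]; push_cast; ring
  unfold q6
  rw [hcast]
  exact inv_cube_le_ceilDiv hP _

/-- Plumbing (`boxNat6`). [folklore] -/
private def boxNat6 (P N : ℕ) : ℕ :=
  ∑ i ∈ Finset.range (2 * N + 1), ∑ j ∈ Finset.range (2 * N + 1), ∑ l ∈ Finset.range (2 * N + 1),
    ceilDiv P ((((i : ℤ) - N) ^ 2 + ((j : ℤ) - N) ^ 2 + ((l : ℤ) - N) ^ 2).toNat ^ 3)

/-- Plumbing (`boxSum_q6_le_boxNat6`). [folklore] -/
private theorem boxSum_q6_le_boxNat6 {P : ℕ} (hP : 0 < P) (N : ℕ) :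
    boxSum q6 N ≤ (boxNat6 P N : ℝ) / P := by
  unfold boxSum boxNat6
  simp only [sum_symmRange_eq_sum_range]
  push_cast
  simp_rw [Finset.sum_div]
  gcongr with i _ j _ l _
  exact q6_le_ceilDiv hP _ _ _

set_option maxRecDepth 100000 in
/-- Plumbing (`boxNat6_25`). [folklore] -/
private theorem boxNat6_25 : boxNat6 (10 ^ 8) 25 = 840263010 := by
  decide +kernel

/-- Plumbing (`boxSum_q6_25_le`). [folklore] -/
private theorem boxSum_q6_25_le : boxSum q6 25 ≤ 8.4026301 := by
  have h := boxSum_q6_le_boxNat6 (P := 10 ^ 8) (by norm_num) 25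
  rw [boxNat6_25] at h
  norm_num at h ⊢
  linarith

/-- Plumbing (`Q6`). [folklore] -/
private def Q6 (p : ℤ × ℤ × ℤ) : ℝ := q6 p.1 p.2.1 p.2.2

/-- Plumbing (`Q6_nonneg`). [folklore] -/
private theorem Q6_nonneg (p : ℤ × ℤ × ℤ) : 0 ≤ Q6 p := q6_nonneg _ _ _

/-- Plumbing (`sum_Q6_le`). [folklore] -/
private theorem sum_Q6_le (u : Finset (ℤ × ℤ × ℤ)) :
    ∑ p ∈ u, Q6 p ≤ boxSum q6 25 + ((((25 : ℕ) : ℝ) + 1) ^ 2)⁻¹ * tail4 25 := by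
  obtain ⟨M, hM⟩ := exists_subset_cube u
  calc ∑ p ∈ u, Q6 p ≤ ∑ p ∈ symmRange M ×ˢ (symmRange M ×ˢ symmRange M), Q6 p :=
        Finset.sum_le_sum_of_subset_of_nonneg hM fun p _ _ => Q6_nonneg p
    _ = boxSum q6 M := (boxSum_eq_sum_cube q6 M).symm
    _ ≤ _ := boxSum_q6_le 25 (by norm_num) M

/-- Plumbing (`summable_Q6`). [folklore] -/
private theorem summable_Q6 : Summable Q6 := summable_of_sum_le Q6_nonneg sum_Q6_le

/-- **Upper enclosure**: `∑'_{k ∈ ℤ³} |k|⁻⁶ ≤ 8.4034`. [folklore] -/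
private theorem tsum_Q6_le : ∑' p, Q6 p ≤ 8.4034 := by
  have h := Real.tsum_le_of_sum_le Q6_nonneg sum_Q6_le
  have ht := tail4_25_le
  have : ((((25 : ℕ) : ℝ) + 1) ^ 2)⁻¹ * tail4 25 ≤ 0.00074 := by
    norm_num
    nlinarith [tail4_nonneg 25]
  linarith [boxSum_q6_25_le]

/-! ### Lower certificate for `|k|⁻⁶` -/

/-- Plumbing (`floorDiv_le_inv_cube`). [folklore] -/
private theorem floorDiv_le_inv_cube {P : ℕ} (hP : 0 < P) (m : ℕ) :
    ((P / m ^ 3 : ℕ) : ℝ) / P ≤ (((m : ℝ)) ^ 3)⁻¹ := by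
  rcases Nat.eq_zero_or_pos m with hm | hm
  · subst hm; simp
  · have hy : 0 < m ^ 3 := by positivity
    have h := Nat.div_mul_le_self P (m ^ 3)
    have hPr : (0 : ℝ) < P := by exact_mod_cast hP
    have hyr : (0 : ℝ) < (m : ℝ) ^ 3 := by positivity
    rw [inv_eq_one_div, div_le_div_iff₀ hPr hyr, one_mul]
    exact_mod_cast h

/-- Plumbing (`floorDiv_le_q6`). [folklore] -/
private theorem floorDiv_le_q6 {P : ℕ} (hP : 0 < P) (a b c : ℤ) :
    ((P / ((a ^ 2 + b ^ 2 + c ^ 2).toNat ^ 3) : ℕ) : ℝ) / P ≤ q6 a b c := by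
  have hs : 0 ≤ a ^ 2 + b ^ 2 + c ^ 2 := by positivity
  have hcast : ((a : ℝ) ^ 2 + (b : ℝ) ^ 2 + (c : ℝ) ^ 2) = (((a ^ 2 + b ^ 2 + c ^ 2).toNat : ℕ) : ℝ) := by
    have h1 : (((a ^ 2 + b ^ 2 + c ^ 2).toNat : ℕ) : ℤ) = a ^ 2 + b ^ 2 + c ^ 2 := Int.toNat_of_nonneg hs
    have h2 : (((a ^ 2 + b ^ 2 + c ^ 2).toNat : ℕ) : ℝ) = (((a ^ 2 + b ^ 2 + c ^ 2 : ℤ)) : ℝ) := by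
      exact_mod_cast h1
    rw [h2]; push_cast; ring
  unfold q6
  rw [hcast]
  exact floorDiv_le_inv_cube hP _

/-- Plumbing (`boxNat6Floor`). [folklore] -/
private def boxNat6Floor (P N : ℕ) : ℕ :=
  ∑ i ∈ Finset.range (2 * N + 1), ∑ j ∈ Finset.range (2 * N + 1), ∑ l ∈ Finset.range (2 * N + 1),
    P / ((((i : ℤ) - N) ^ 2 + ((j : ℤ) - N) ^ 2 + ((l : ℤ) - N) ^ 2).toNat ^ 3)

/-- Plumbing (`boxNat6Floor_le_boxSum_q6`). [folklore] -/
private theorem boxNat6Floor_le_boxSum_q6 {P : ℕ} (hP : 0 < P) (N : ℕ) :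
    (boxNat6Floor P N : ℝ) / P ≤ boxSum q6 N := by
  unfold boxSum boxNat6Floor
  simp only [sum_symmRange_eq_sum_range]
  push_cast
  simp_rw [Finset.sum_div]
  gcongr with i _ j _ l _
  exact floorDiv_le_q6 hP _ _ _

set_option maxRecDepth 100000 in
/-- Plumbing (`boxNat6Floor_25`). [folklore] -/
private theorem boxNat6Floor_25 : boxNat6Floor (10 ^ 8) 25 = 840130600 := by
  decide +kernel

/-- Plumbing (`le_tsum_Q6`). [folklore] -/
private theorem le_tsum_Q6 : (8.401306 : ℝ) ≤ ∑' p, Q6 p := by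
  have h := boxNat6Floor_le_boxSum_q6 (P := 10 ^ 8) (by norm_num) 25
  rw [boxNat6Floor_25] at h
  norm_num at h
  refine le_trans (by linarith) ((boxSum_eq_sum_cube q6 25).le.trans ?_)
  exact summable_Q6.sum_le_tsum _ (fun p _ => Q6_nonneg p)

/-! ### Transfer to `d → ℤ` with `Fintype.card d = 3` -/

open Literature.Analysis.FunctionSpaces Literature.Analysis.FunctionSpaces.Torus in
/-- Plumbing (`transfer`). [folklore] -/
private theorem transfer {d : Type*} [Fintype d] (hd : Fintype.card d = 3) (Φ : ℝ → ℝ) :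
    (∑' k : d → ℤ, Φ (freqNormSq k)) =
      ∑' p : ℤ × ℤ × ℤ, Φ ((p.1 : ℝ) ^ 2 + (p.2.1 : ℝ) ^ 2 + (p.2.2 : ℝ) ^ 2) ∧
    (Summable (fun k : d → ℤ => Φ (freqNormSq k)) ↔
      Summable (fun p : ℤ × ℤ × ℤ => Φ ((p.1 : ℝ) ^ 2 + (p.2.1 : ℝ) ^ 2 + (p.2.2 : ℝ) ^ 2))) := by
  classical
  obtain ⟨e⟩ : Nonempty (d ≃ Fin 3) := ⟨Fintype.equivFinOfCardEq hd⟩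
  let E : ℤ × ℤ × ℤ ≃ (d → ℤ) :=
    { toFun := fun p i => ![p.1, p.2.1, p.2.2] (e i)
      invFun := fun k => (k (e.symm 0), k (e.symm 1), k (e.symm 2))
      left_inv := fun p => by ext <;> simp
      right_inv := fun k => by
        funext i
        obtain ⟨j, hj⟩ : ∃ j, e i = j := ⟨_, rfl⟩
        have hi : i = e.symm j := by rw [← hj, Equiv.symm_apply_apply]
        subst hi
        simp only [Equiv.apply_symm_apply]
        fin_cases j <;> rfl }
  have hE : ∀ p : ℤ × ℤ × ℤ, freqNormSq (E p) = (p.1 : ℝ) ^ 2 + (p.2.1 : ℝ) ^ 2 + (p.2.2 : ℝ) ^ 2 := by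
    intro p
    rw [freqNormSq, ← Equiv.sum_comp e.symm]
    simp only [Fin.sum_univ_three, E, Equiv.coe_fn_mk, Equiv.apply_symm_apply, Matrix.cons_val_zero,
      Matrix.cons_val_one, Matrix.cons_val_two, Matrix.head_cons, Matrix.tail_cons]
  have hfun : (fun p : ℤ × ℤ × ℤ => Φ (freqNormSq (E p))) =
      fun p => Φ ((p.1 : ℝ) ^ 2 + (p.2.1 : ℝ) ^ 2 + (p.2.2 : ℝ) ^ 2) := funext fun p => by rw [hE]
  refine ⟨?_, ?_⟩
  · rw [← Equiv.tsum_eq E (fun k => Φ (freqNormSq k))]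
    exact congrArg tsum hfun ▸ rfl
  · rw [← Equiv.summable_iff E]
    change Summable (fun p => Φ (freqNormSq (E p))) ↔ _
    rw [hfun]

end CubicLattice

/-! ## Public statements -/

section Public

variable {d : Type*} [Fintype d]

/-- **Jones–Ingham's simple-cubic lattice sum `A₄ = ∑'_{k ∈ ℤ³∖0} |k|⁻⁴ = 16.5323`, upper
enclosure** on `ℤ × ℤ × ℤ`: `∑' ((a² + b² + c²)²)⁻¹ ≤ 16.6213` (the origin contributes `0⁻¹ = 0`).
[cite: JonesIngham1925, Table I (simple cubic, A₄ = 16.5323); BausTejero2021, Table 8.2] -/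
theorem tsum_int3_inv_normSq_sq_le :
    ∑' p : ℤ × ℤ × ℤ, ((((p.1 : ℝ)) ^ 2 + (p.2.1 : ℝ) ^ 2 + (p.2.2 : ℝ) ^ 2) ^ 2)⁻¹ ≤ 16.6213 :=
  CubicLattice.tsum_Q4_le

/-- Lower enclosure `16.1221115 ≤ ∑'_{k ∈ ℤ³} |k|⁻⁴` (the box `‖k‖∞ ≤ 25` alone).
[cite: JonesIngham1925, Table I (simple cubic, A₄ = 16.5323); BausTejero2021, Table 8.2] -/
theorem le_tsum_int3_inv_normSq_sq :
    (16.1221115 : ℝ) ≤ ∑' p : ℤ × ℤ × ℤ, ((((p.1 : ℝ)) ^ 2 + (p.2.1 : ℝ) ^ 2 + (p.2.2 : ℝ) ^ 2) ^ 2)⁻¹ :=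
  CubicLattice.le_tsum_Q4'

/-- Summability of `|k|⁻⁴` over `ℤ³` (bounded partial sums of a nonnegative family).
[cite: JonesIngham1925, Table I] -/
theorem summable_int3_inv_normSq_sq :
    Summable fun p : ℤ × ℤ × ℤ => ((((p.1 : ℝ)) ^ 2 + (p.2.1 : ℝ) ^ 2 + (p.2.2 : ℝ) ^ 2) ^ 2)⁻¹ :=
  CubicLattice.summable_Q4

/-- **Jones–Ingham's `A₆ = ∑'_{k ∈ ℤ³∖0} |k|⁻⁶ = 8.40192`, upper enclosure**: `≤ 8.4034`.
[cite: JonesIngham1925, Table I (simple cubic, A₆ = 8.40192); BausTejero2021, Table 8.2] -/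
theorem tsum_int3_inv_normSq_cube_le :
    ∑' p : ℤ × ℤ × ℤ, ((((p.1 : ℝ)) ^ 2 + (p.2.1 : ℝ) ^ 2 + (p.2.2 : ℝ) ^ 2) ^ 3)⁻¹ ≤ 8.4034 :=
  CubicLattice.tsum_Q6_le

/-- Lower enclosure `8.401306 ≤ ∑'_{k ∈ ℤ³} |k|⁻⁶`.
[cite: JonesIngham1925, Table I (simple cubic, A₆ = 8.40192); BausTejero2021, Table 8.2] -/
theorem le_tsum_int3_inv_normSq_cube :
    (8.401306 : ℝ) ≤ ∑' p : ℤ × ℤ × ℤ, ((((p.1 : ℝ)) ^ 2 + (p.2.1 : ℝ) ^ 2 + (p.2.2 : ℝ) ^ 2) ^ 3)⁻¹ :=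
  CubicLattice.le_tsum_Q6

/-- Summability of `|k|⁻⁶` over `ℤ³`. [cite: JonesIngham1925, Table I] -/
theorem summable_int3_inv_normSq_cube :
    Summable fun p : ℤ × ℤ × ℤ => ((((p.1 : ℝ)) ^ 2 + (p.2.1 : ℝ) ^ 2 + (p.2.2 : ℝ) ^ 2) ^ 3)⁻¹ :=
  CubicLattice.summable_Q6

/-- **`ζ₄(ℤ³) = ∑'_k (freqNormSq k)⁻² ≤ 16.6213`** for `Fintype.card d = 3` (Jones–Ingham
`A₄ = 16.5323`). [cite: JonesIngham1925, Table I (simple cubic, A₄ = 16.5323); BausTejero2021, Table 8.2] -/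
theorem tsum_inv_freqNormSq_sq_le_three (hd : Fintype.card d = 3) :
    ∑' k : d → ℤ, ((freqNormSq k) ^ 2)⁻¹ ≤ 16.6213 := by
  have h : ∑' k : d → ℤ, ((freqNormSq k) ^ 2)⁻¹ =
      ∑' p : ℤ × ℤ × ℤ, ((((p.1 : ℝ)) ^ 2 + (p.2.1 : ℝ) ^ 2 + (p.2.2 : ℝ) ^ 2) ^ 2)⁻¹ :=
    (CubicLattice.transfer hd (fun x => (x ^ 2)⁻¹)).1
  rw [h]; exact tsum_int3_inv_normSq_sq_le

/-- `16.1221115 ≤ ζ₄(ℤ³) = ∑'_k (freqNormSq k)⁻²` (`card d = 3`).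
[cite: JonesIngham1925, Table I (simple cubic, A₄ = 16.5323); BausTejero2021, Table 8.2] -/
theorem le_tsum_inv_freqNormSq_sq_three (hd : Fintype.card d = 3) :
    (16.1221115 : ℝ) ≤ ∑' k : d → ℤ, ((freqNormSq k) ^ 2)⁻¹ := by
  have h : ∑' k : d → ℤ, ((freqNormSq k) ^ 2)⁻¹ =
      ∑' p : ℤ × ℤ × ℤ, ((((p.1 : ℝ)) ^ 2 + (p.2.1 : ℝ) ^ 2 + (p.2.2 : ℝ) ^ 2) ^ 2)⁻¹ :=
    (CubicLattice.transfer hd (fun x => (x ^ 2)⁻¹)).1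
  rw [h]; exact le_tsum_int3_inv_normSq_sq

/-- Summability of `(freqNormSq k)⁻²` on `ℤ^d`, `card d = 3`. [cite: JonesIngham1925, Table I] -/
theorem summable_inv_freqNormSq_sq_three (hd : Fintype.card d = 3) :
    Summable fun k : d → ℤ => ((freqNormSq k) ^ 2)⁻¹ :=
  (CubicLattice.transfer hd (fun x => (x ^ 2)⁻¹)).2.2 summable_int3_inv_normSq_sq

/-- **`ζ₆(ℤ³) = ∑'_k (freqNormSq k)⁻³ ≤ 8.4034`** (`card d = 3`; Jones–Ingham `A₆ = 8.40192`).
[cite: JonesIngham1925, Table I (simple cubic, A₆ = 8.40192); BausTejero2021, Table 8.2] -/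
theorem tsum_inv_freqNormSq_cube_le_three (hd : Fintype.card d = 3) :
    ∑' k : d → ℤ, ((freqNormSq k) ^ 3)⁻¹ ≤ 8.4034 := by
  have h : ∑' k : d → ℤ, ((freqNormSq k) ^ 3)⁻¹ =
      ∑' p : ℤ × ℤ × ℤ, ((((p.1 : ℝ)) ^ 2 + (p.2.1 : ℝ) ^ 2 + (p.2.2 : ℝ) ^ 2) ^ 3)⁻¹ :=
    (CubicLattice.transfer hd (fun x => (x ^ 3)⁻¹)).1
  rw [h]; exact tsum_int3_inv_normSq_cube_le

/-- `8.401306 ≤ ζ₆(ℤ³)` (`card d = 3`).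
[cite: JonesIngham1925, Table I (simple cubic, A₆ = 8.40192); BausTejero2021, Table 8.2] -/
theorem le_tsum_inv_freqNormSq_cube_three (hd : Fintype.card d = 3) :
    (8.401306 : ℝ) ≤ ∑' k : d → ℤ, ((freqNormSq k) ^ 3)⁻¹ := by
  have h : ∑' k : d → ℤ, ((freqNormSq k) ^ 3)⁻¹ =
      ∑' p : ℤ × ℤ × ℤ, ((((p.1 : ℝ)) ^ 2 + (p.2.1 : ℝ) ^ 2 + (p.2.2 : ℝ) ^ 2) ^ 3)⁻¹ :=
    (CubicLattice.transfer hd (fun x => (x ^ 3)⁻¹)).1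
  rw [h]; exact le_tsum_int3_inv_normSq_cube

/-- Summability of `(freqNormSq k)⁻³` on `ℤ^d`, `card d = 3`. [cite: JonesIngham1925, Table I] -/
theorem summable_inv_freqNormSq_cube_three (hd : Fintype.card d = 3) :
    Summable fun k : d → ℤ => ((freqNormSq k) ^ 3)⁻¹ :=
  (CubicLattice.transfer hd (fun x => (x ^ 3)⁻¹)).2.2 summable_int3_inv_normSq_cube

/-- The `rpow` shape of the `Ḣ^s` control files at `s = 3`: pointwise,
`(if k = 0 then 0 else freqNormSq k ^ (−2)) = (freqNormSq k)⁻²`. [folklore] -/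
private theorem ite_rpow_neg_two_eq (k : d → ℤ) :
    (if k = 0 then (0 : ℝ) else freqNormSq k ^ (-(2 : ℝ))) = ((freqNormSq k) ^ 2)⁻¹ := by
  by_cases hk : k = 0
  · subst hk; simp [freqNormSq_zero]
  · rw [if_neg hk, Real.rpow_neg (freqNormSq_nonneg k), Real.rpow_two]

/-- Pointwise, `(if k = 0 then 0 else freqNormSq k ^ (−3)) = (freqNormSq k)⁻³`. [folklore] -/
private theorem ite_rpow_neg_three_eq (k : d → ℤ) :
    (if k = 0 then (0 : ℝ) else freqNormSq k ^ (-(3 : ℝ))) = ((freqNormSq k) ^ 3)⁻¹ := by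
  by_cases hk : k = 0
  · subst hk; simp [freqNormSq_zero]
  · rw [if_neg hk, Real.rpow_neg (freqNormSq_nonneg k), show (3 : ℝ) = ((3 : ℕ) : ℝ) by norm_num,
      Real.rpow_natCast]

/-- **`∑'_k [k ≠ 0] (freqNormSq k)^{−2} ≤ 16.6213`** in the `rpow` shape of
`TorusNSKatoPairInequality` / `TorusNSSobolevControlInequality` at `s = 3` (`card d = 3`).
[cite: JonesIngham1925, Table I (simple cubic, A₄ = 16.5323); BausTejero2021, Table 8.2] -/
theorem tsum_ite_freqNormSq_rpow_neg_two_le_three (hd : Fintype.card d = 3) :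
    ∑' k : d → ℤ, (if k = 0 then (0 : ℝ) else freqNormSq k ^ (-(2 : ℝ))) ≤ 16.6213 := by
  simp_rw [ite_rpow_neg_two_eq]; exact tsum_inv_freqNormSq_sq_le_three hd

/-- `16.1221115 ≤ ∑'_k [k ≠ 0] (freqNormSq k)^{−2}` (`rpow` shape, `card d = 3`).
[cite: JonesIngham1925, Table I (simple cubic, A₄ = 16.5323); BausTejero2021, Table 8.2] -/
theorem le_tsum_ite_freqNormSq_rpow_neg_two_three (hd : Fintype.card d = 3) :
    (16.1221115 : ℝ) ≤ ∑' k : d → ℤ, (if k = 0 then (0 : ℝ) else freqNormSq k ^ (-(2 : ℝ))) := by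
  simp_rw [ite_rpow_neg_two_eq]; exact le_tsum_inv_freqNormSq_sq_three hd

/-- Summability in the `rpow` shape, exponent `−2`. [cite: JonesIngham1925, Table I] -/
theorem summable_ite_freqNormSq_rpow_neg_two_three (hd : Fintype.card d = 3) :
    Summable fun k : d → ℤ => (if k = 0 then (0 : ℝ) else freqNormSq k ^ (-(2 : ℝ))) := by
  simp_rw [ite_rpow_neg_two_eq]; exact summable_inv_freqNormSq_sq_three hd

/-- **`∑'_k [k ≠ 0] (freqNormSq k)^{−3} ≤ 8.4034`** (`rpow` shape, `card d = 3`).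
[cite: JonesIngham1925, Table I (simple cubic, A₆ = 8.40192); BausTejero2021, Table 8.2] -/
theorem tsum_ite_freqNormSq_rpow_neg_three_le_three (hd : Fintype.card d = 3) :
    ∑' k : d → ℤ, (if k = 0 then (0 : ℝ) else freqNormSq k ^ (-(3 : ℝ))) ≤ 8.4034 := by
  simp_rw [ite_rpow_neg_three_eq]; exact tsum_inv_freqNormSq_cube_le_three hd

/-- `8.401306 ≤ ∑'_k [k ≠ 0] (freqNormSq k)^{−3}` (`rpow` shape, `card d = 3`).
[cite: JonesIngham1925, Table I (simple cubic, A₆ = 8.40192); BausTejero2021, Table 8.2] -/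
theorem le_tsum_ite_freqNormSq_rpow_neg_three_three (hd : Fintype.card d = 3) :
    (8.401306 : ℝ) ≤ ∑' k : d → ℤ, (if k = 0 then (0 : ℝ) else freqNormSq k ^ (-(3 : ℝ))) := by
  simp_rw [ite_rpow_neg_three_eq]; exact le_tsum_inv_freqNormSq_cube_three hd

/-- Summability in the `rpow` shape, exponent `−3`. [cite: JonesIngham1925, Table I] -/
theorem summable_ite_freqNormSq_rpow_neg_three_three (hd : Fintype.card d = 3) :
    Summable fun k : d → ℤ => (if k = 0 then (0 : ℝ) else freqNormSq k ^ (-(3 : ℝ))) := by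
  simp_rw [ite_rpow_neg_three_eq]; exact summable_inv_freqNormSq_cube_three hd

end Public

end Literature.Analysis.FunctionSpaces.Torus
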